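import Mathlib.MeasureTheory.Integral.PeakFunction
import Literature.Analysis.FluidPDE.RegularisedStokeslet
import Literature.Analysis.FluidPDE.NewtonKernel
import HarnessLib

/-!
# A pressure-free pointwise bound for Leray profiles via the regularised Stokeslet

Analysis/FluidPDE support file (all results proved) for the discharge of the named fact
`Literature.Analysis.FluidPDE.tsai1998_lemma33` (T.-P. Tsai, *On Leray's self-similar solutions
of the Navier–Stokes equations satisfying local energy estimates*, Arch. Rational Mech. Anal.
143 (1998) 29–51, **Lemma 3.3**, p. 40: a weak solution `U ∈ L^q(ℝ³)`, `3 < q < ∞`, of Leray's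
profile system (1.3) satisfies `U(y) = o(|y|)`). Sequel of `RegularisedStokeslet`; used by
`TsaiGrowthLemmasProofs`.

## What is proved

For the tree's pointwise profile class `IsLerayProfile ν a U P` on `ℝ³` (`U ∈ C²`, `P ∈ C¹`,
`−νΔU + aU + a(y·∇)U + (U·∇)U + ∇P = 0`, `div U = 0`; `ν > 0`, `a ≥ 0`) the main theorem
`IsLerayProfile.ofReal_norm_le_lintegral_ker` gives a constant `C` with, for **every** `y`,

  `|U(y)| ≤ C [ (1 + |y|) ∫_{|z−y|≤1} |U(z)| |z−y|⁻² dz + ∫_{|z−y|≤1} |U(z)|² |z−y|⁻² dz ]`,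

stated in `ℝ≥0∞` so that no integrability needs to be presupposed. This is the content of
Tsai's §3.3 (proof of Lemma 3.3, pp. 40–42): Green's representation formula for the Stokes
system on `B_ρ(y₀)` and the estimates of the terms `I₁, …, I₅` at the centre (Remark 3.2 (i):
"It is enough to assume that `y = y₀`"), with the drift `a(z·∇)U` and the convection `(U·∇)U`
integrated by parts onto the kernel (`|∇G| ≲ |y−z|⁻²`, his (3.7)); the gradient/Hardy step for
`I₄` is *not* performed here (the quadratic term is kept as it is and bootstrapped in
`TsaiGrowthLemmasProofs`).

## How (design)

Mathlib has neither the Green tensor of the Stokes system on a ball (Cattabriga; Galdi I,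
pp. 226–234) nor Calderón–Zygmund theory for the pressure. Both are avoided: we test the profile
system, in the coordinates of `IsLerayProfile.profile_comp` (`TsaiHeadPressure`), against the
smooth, compactly supported and **exactly divergence-free** field

  `Vᵢ = ∑ₗ ∂ₗ(W τₗᵢ)`,  `τₗᵢ = δₗⱼ ∂ᵢΦ_ε − δᵢⱼ ∂ₗΦ_ε` (antisymmetric),  `W = radialCutoff ½ 1`,

translated to the point `y`, where `Φ_ε = −√(|x|²+ε²)` is the regularised Stokeslet potential of
`RegularisedStokeslet`. Then (i) the pressure term is `−∫ P div V = 0` identically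
(`sum_integral_pderiv_pressure_mul_Vt`); (ii) `V = W G + ∇W·τ` with `G` the regularised Stokeslet,
so `|V|, |∇V| ≤ C|x|⁻²` on the unit ball uniformly in `ε` (`test_field_bounds`); (iii)
`ΔVᵢ = Rᵢ + W(∂ᵢ∂ⱼΔΦ_ε − δᵢⱼΨ_ε)` with `Rᵢ` and `∂ⱼΔΦ_ε` bounded on the annulus
(`sum_pderiv_dV`), where `Ψ_ε = Δ²Φ_ε` is a positive approximate identity; (iv) two integrations
by parts of the viscous term, one of the drift and of the convection (`integral_lap_mul_Vt`,
`integral_drift_mul_Vt`, `integral_convect_mul_Vt`, `sum_integral_mul_cut_E2`, all through the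
tree's `integral_mul_pderiv_eq_neg`) give the master identity `integral_cut_Psi_eq`:
`ν ∫ Uⱼ W(·−y) Ψ_ε(·−y)` = integrals of `U` and `U⊗U` against the structure functions; (v) the
left side tends to `(∫Ψ₁) Uⱼ(y)` as `ε → 0` (`tendsto_integral_cut_Psi`, Mathlib's
`tendsto_integral_comp_smul_smul_of_integrable`), while the right side is bounded uniformly in
`ε` by the two kernel integrals.

## Contents

* the cutoff `Stokeslet.cut` and its derivatives `dcut`, `ddcut`, `dddcut` (bounded, vanishing
  on `flatSet = {|x| < ½} ∪ {|x| > 1}`);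
* the test field `Stokeslet.tau/dtau/ddtau/Gt/dGt/V/dV/R`, the identities `pderiv_V`,
  `sum_pderiv_dV`, `sum_pderiv_V` (`div V = 0`), and the bounds `test_field_bounds(_ker)` with
  the truncated kernel `Stokeslet.ker x = |x|⁻² 1_{|x|≤1}`;
* the integrations by parts (A)–(E) and `integral_cut_Psi_eq`;
* `tendsto_integral_cut_Psi`, `IsLerayProfile.ofReal_norm_le_lintegral_ker`.

## References

* T.-P. Tsai, *On Leray's self-similar solutions of the Navier–Stokes equations satisfying local
  energy estimates*, Arch. Rational Mech. Anal. 143 (1998) 29–51, §3.3, Lemma 3.3, Remark 3.2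
  [Tsai1998].
* R. Cortez, *The method of regularized Stokeslets*, SIAM J. Sci. Comput. 23 (2001) 1204–1225,
  §2. [folklore formulas]
* G. P. Galdi, *An introduction to the mathematical theory of the Navier–Stokes equations*, I,
  Springer (1994), IV.2, IV.8 (fundamental solution and Green's identity for the Stokes system).
-/

noncomputable section

open MeasureTheory Set Filter Topology InnerProductSpace Function Real Metric
open scoped RealInnerProductSpace ContDiff BigOperators ENNReal

namespace Literature.Analysis.FluidPDE

namespace Stokeslet

/-- Local notation for physical space `ℝ³ = EuclideanSpace ℝ (Fin 3)`. -/
local notation "𝔼" => EuclideanSpace ℝ (Fin 3)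

/-! ### The cutoff and its coordinate derivatives -/

/-- The radial cutoff `W = θ_{1/2,1}`: smooth, `W = 1` on `|x| ≤ 1/2`, `W = 0` on `|x| ≥ 1`,
`0 ≤ W ≤ 1` (the tree's `radialCutoff`). [folklore] -/
def cut : 𝔼 → ℝ := radialCutoff (1 / 2) 1

/-- `∂ₗW`. [folklore] -/
def dcut (l : Fin 3) : 𝔼 → ℝ := pderiv l cut

/-- `∂ₖ∂ₗW`. [folklore] -/
def ddcut (k l : Fin 3) : 𝔼 → ℝ := pderiv k (dcut l)

/-- `∂ₘ∂ₖ∂ₗW`. [folklore] -/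
def dddcut (m k l : Fin 3) : 𝔼 → ℝ := pderiv m (ddcut k l)

/-- `W` is smooth. [folklore] -/
theorem contDiff_cut : ContDiff ℝ ∞ cut := radialCutoff_contDiff (1 / 2) 1 (n := ⊤)

/-- `∂ₗW` is smooth. [folklore] -/
theorem contDiff_dcut (l : Fin 3) : ContDiff ℝ ∞ (dcut l) := contDiff_pderiv contDiff_cut l

/-- `∂ₖ∂ₗW` is smooth. [folklore] -/
theorem contDiff_ddcut (k l : Fin 3) : ContDiff ℝ ∞ (ddcut k l) := contDiff_pderiv (contDiff_dcut l) k

/-- `∂ₘ∂ₖ∂ₗW` is smooth. [folklore] -/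
theorem contDiff_dddcut (m k l : Fin 3) : ContDiff ℝ ∞ (dddcut m k l) :=
  contDiff_pderiv (contDiff_ddcut k l) m

/-- `W = 1` on the closed ball of radius `1/2`. [folklore] -/
theorem cut_eq_one {x : 𝔼} (hx : ‖x‖ ≤ 1 / 2) : cut x = 1 :=
  radialCutoff_eq_one (by norm_num) (by norm_num) hx

/-- `W = 0` off the open unit ball. [folklore] -/
theorem cut_eq_zero {x : 𝔼} (hx : 1 ≤ ‖x‖) : cut x = 0 :=
  radialCutoff_eq_zero (by norm_num) (by norm_num) hx

/-- `W(0) = 1`. [folklore] -/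
theorem cut_zero : cut (0 : 𝔼) = 1 := cut_eq_one (by simp)

/-- `|W| ≤ 1`. [folklore] -/
theorem abs_cut_le (x : 𝔼) : |cut x| ≤ 1 := abs_radialCutoff_le_one _ _ x

/-- `W` has compact support. [folklore] -/
theorem hasCompactSupport_cut : HasCompactSupport cut :=
  hasCompactSupport_radialCutoff (E := 𝔼) (by norm_num) (by norm_num)

/-- A function constant on an open set has vanishing partial derivatives there. [folklore] -/
theorem pderiv_eq_zero_of_eqOn {f : 𝔼 → ℝ} {S : Set 𝔼} (hS : IsOpen S) {c : ℝ}
    (h : EqOn f (fun _ => c) S) (l : Fin 3) {x : 𝔼} (hx : x ∈ S) : pderiv l f x = 0 := by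
  have he : f =ᶠ[𝓝 x] fun _ => c := h.eventuallyEq_of_mem (hS.mem_nhds hx)
  rw [pderiv_apply, he.fderiv_eq]
  simp

/-- The open set where `W` is locally constant: `|x| < 1/2` or `|x| > 1`. [folklore] -/
def flatSet : Set 𝔼 := ball 0 (1 / 2) ∪ (closedBall 0 1)ᶜ

/-- `flatSet` is open. [folklore] -/
theorem isOpen_flatSet : IsOpen flatSet := isOpen_ball.union isClosed_closedBall.isOpen_compl

/-- `∂ₗW = 0` on `flatSet`. [folklore] -/
theorem dcut_eq_zero (l : Fin 3) {x : 𝔼} (hx : x ∈ flatSet) : dcut l x = 0 := by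
  rcases hx with hx | hx
  · refine pderiv_eq_zero_of_eqOn isOpen_ball (c := 1) (fun z hz => ?_) l hx
    exact cut_eq_one (by rw [mem_ball_zero_iff] at hz; linarith)
  · refine pderiv_eq_zero_of_eqOn isClosed_closedBall.isOpen_compl (c := 0) (fun z hz => ?_) l hx
    have : 1 < ‖z‖ := by simpa using hz
    exact cut_eq_zero this.le

/-- `∂ₖ∂ₗW = 0` on `flatSet`. [folklore] -/
theorem ddcut_eq_zero (k l : Fin 3) {x : 𝔼} (hx : x ∈ flatSet) : ddcut k l x = 0 :=
  pderiv_eq_zero_of_eqOn isOpen_flatSet (c := 0) (fun _ hz => dcut_eq_zero l hz) k hx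

/-- `∂ₘ∂ₖ∂ₗW = 0` on `flatSet`. [folklore] -/
theorem dddcut_eq_zero (m k l : Fin 3) {x : 𝔼} (hx : x ∈ flatSet) : dddcut m k l x = 0 :=
  pderiv_eq_zero_of_eqOn isOpen_flatSet (c := 0) (fun _ hz => ddcut_eq_zero k l hz) m hx

/-- Points with `‖x‖ < 1/2` or `1 < ‖x‖` lie in `flatSet`. [folklore] -/
theorem mem_flatSet_of_lt {x : 𝔼} (hx : ‖x‖ < 1 / 2) : x ∈ flatSet := Or.inl (mem_ball_zero_iff.2 hx)

/-- Points with `1 < ‖x‖` lie in `flatSet`. [folklore] -/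
theorem mem_flatSet_of_gt {x : 𝔼} (hx : 1 < ‖x‖) : x ∈ flatSet :=
  Or.inr (by simpa using hx)

/-- `∂ₖ∂ₗW = ∂ₗ∂ₖW`. [folklore] -/
theorem ddcut_comm (k l : Fin 3) : ddcut k l = ddcut l k := pderiv_comm contDiff_cut k l

/-- **Uniform bound on the cutoff derivatives**: one constant `M ≥ 1` bounding `|W|`, `|∂W|`,
`|∂²W|`, `|∂³W|`. [folklore] -/
theorem exists_cut_bound : ∃ M : ℝ, 1 ≤ M ∧ (∀ x, |cut x| ≤ M) ∧ (∀ l x, |dcut l x| ≤ M) ∧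
    (∀ k l x, |ddcut k l x| ≤ M) ∧ (∀ m k l x, |dddcut m k l x| ≤ M) := by
  have hb1 : ∀ l, ∃ C, ∀ x, |dcut l x| ≤ C := fun l => by
    obtain ⟨C, hC⟩ := (hasCompactSupport_cut.fderiv_apply (𝕜 := ℝ) (stdVec l)).exists_bound_of_continuous
      (continuous_pderiv contDiff_cut (by simp) l)
    exact ⟨C, fun x => by have h := hC x; rw [Real.norm_eq_abs] at h; exact h⟩
  have hc2 : ∀ l, HasCompactSupport (dcut l) := fun l =>
    hasCompactSupport_cut.fderiv_apply (𝕜 := ℝ) (stdVec l)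
  have hc3 : ∀ k l, HasCompactSupport (ddcut k l) := fun k l =>
    (hc2 l).fderiv_apply (𝕜 := ℝ) (stdVec k)
  have hb2 : ∀ k l, ∃ C, ∀ x, |ddcut k l x| ≤ C := fun k l => by
    obtain ⟨C, hC⟩ := (hc3 k l).exists_bound_of_continuous
      (continuous_pderiv (contDiff_dcut l) (by simp) k)
    exact ⟨C, fun x => by have h := hC x; rw [Real.norm_eq_abs] at h; exact h⟩
  have hb3 : ∀ m k l, ∃ C, ∀ x, |dddcut m k l x| ≤ C := fun m k l => by
    obtain ⟨C, hC⟩ := ((hc3 k l).fderiv_apply (𝕜 := ℝ) (stdVec m)).exists_bound_of_continuous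
      (continuous_pderiv (contDiff_ddcut k l) (by simp) m)
    exact ⟨C, fun x => by have h := hC x; rw [Real.norm_eq_abs] at h; exact h⟩
  choose C1 hC1 using hb1
  choose C2 hC2 using hb2
  choose C3 hC3 using hb3
  refine ⟨1 ⊔ ((Finset.univ.sup' Finset.univ_nonempty C1) ⊔
    ((Finset.univ.sup' Finset.univ_nonempty fun p : Fin 3 × Fin 3 => C2 p.1 p.2) ⊔
    (Finset.univ.sup' Finset.univ_nonempty fun p : Fin 3 × Fin 3 × Fin 3 => C3 p.1 p.2.1 p.2.2))),
    le_sup_left, fun x => (abs_cut_le x).trans le_sup_left, fun l x => ?_, fun k l x => ?_,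
    fun m k l x => ?_⟩
  · refine (hC1 l x).trans (le_sup_right.trans' (le_sup_left.trans' ?_))
    exact Finset.le_sup' C1 (Finset.mem_univ l)
  · refine (hC2 k l x).trans (le_sup_right.trans' (le_sup_right.trans' (le_sup_left.trans' ?_)))
    exact Finset.le_sup' (fun p : Fin 3 × Fin 3 => C2 p.1 p.2) (Finset.mem_univ (k, l))
  · refine (hC3 m k l x).trans (le_sup_right.trans' (le_sup_right.trans' (le_sup_right.trans' ?_)))
    exact Finset.le_sup' (fun p : Fin 3 × Fin 3 × Fin 3 => C3 p.1 p.2.1 p.2.2) (Finset.mem_univ (m, k, l))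

/-! ### The divergence-free test field -/

section TestField

variable (ε : ℝ) (j : Fin 3)

/-- The antisymmetric tensor `τₗᵢ = δₗⱼ ∂ᵢΦ_ε − δᵢⱼ ∂ₗΦ_ε`. [folklore] -/
def tau (l i : Fin 3) (x : 𝔼) : ℝ := kd l j * D1 ε i x - kd i j * D1 ε l x

/-- `∂ₖτₗᵢ`. [folklore] -/
def dtau (k l i : Fin 3) (x : 𝔼) : ℝ := kd l j * D2 ε k i x - kd i j * D2 ε k l x

/-- `∑ₖ ∂ₖ∂ₖτₗᵢ = δₗⱼ ∂ᵢΔΦ_ε − δᵢⱼ ∂ₗΔΦ_ε`. [folklore] -/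
def ddtau (l i : Fin 3) (x : 𝔼) : ℝ := kd l j * E1 ε i x - kd i j * E1 ε l x

/-- The regularised Stokeslet (times `8π`): `Gᵢⱼ = ∑ₗ ∂ₗτₗᵢ = ∂ⱼ∂ᵢΦ_ε − δᵢⱼ ΔΦ_ε`. [folklore] -/
def Gt (i : Fin 3) (x : 𝔼) : ℝ := D2 ε j i x - kd i j * Lap ε x

/-- `∂ₖGᵢⱼ`. [folklore] -/
def dGt (k i : Fin 3) (x : 𝔼) : ℝ := D3 ε k j i x - kd i j * E1 ε k x

/-- **The test field** `Vᵢ = ∑ₗ ∂ₗ(W τₗᵢ) = ∑ₗ ∂ₗW τₗᵢ + W Gᵢⱼ`: smooth, compactly supported,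
exactly divergence free. [folklore] -/
def V (i : Fin 3) (x : 𝔼) : ℝ := (∑ l, dcut l x * tau ε j l i x) + cut x * Gt ε j i x

/-- `∂ₖVᵢ`, explicitly. [folklore] -/
def dV (k i : Fin 3) (x : 𝔼) : ℝ :=
  (∑ l, (ddcut k l x * tau ε j l i x + dcut l x * dtau ε j k l i x)) +
    dcut k x * Gt ε j i x + cut x * dGt ε j k i x

/-- The annulus remainder `Rᵢ = ΔVᵢ − W (∂ᵢ∂ⱼΔΦ_ε − δᵢⱼ Δ²Φ_ε)`: every term carries a
derivative of `W`. [folklore] -/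
def R (i : Fin 3) (x : 𝔼) : ℝ :=
  (∑ l, ((∑ k, dddcut k k l x) * tau ε j l i x + 2 * (∑ k, ddcut k l x * dtau ε j k l i x) +
    dcut l x * ddtau ε j l i x)) +
    (∑ k, ddcut k k x) * Gt ε j i x + 2 * (∑ k, dcut k x * dGt ε j k i x)

variable {ε} {j}

/-! Smoothness. -/

/-- `τ` is smooth. [folklore] -/
theorem contDiff_tau (hε : ε ≠ 0) (l i : Fin 3) : ContDiff ℝ ∞ (tau ε j l i) :=
  (contDiff_const.mul (contDiff_D1 hε i)).sub (contDiff_const.mul (contDiff_D1 hε l))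

/-- `∂τ` is smooth. [folklore] -/
theorem contDiff_dtau (hε : ε ≠ 0) (k l i : Fin 3) : ContDiff ℝ ∞ (dtau ε j k l i) :=
  (contDiff_const.mul (contDiff_D2 hε k i)).sub (contDiff_const.mul (contDiff_D2 hε k l))

/-- `G` is smooth. [folklore] -/
theorem contDiff_Gt (hε : ε ≠ 0) (i : Fin 3) : ContDiff ℝ ∞ (Gt ε j i) :=
  (contDiff_D2 hε j i).sub (contDiff_const.mul (contDiff_Lap hε))

/-- `∂G` is smooth. [folklore] -/
theorem contDiff_dGt (hε : ε ≠ 0) (k i : Fin 3) : ContDiff ℝ ∞ (dGt ε j k i) :=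
  (contDiff_D3 hε k j i).sub (contDiff_const.mul (contDiff_E1 hε k))

/-- `V` is smooth. [folklore] -/
theorem contDiff_V (hε : ε ≠ 0) (i : Fin 3) : ContDiff ℝ ∞ (V ε j i) :=
  (ContDiff.sum fun l _ => (contDiff_dcut l).mul (contDiff_tau hε l i)).add
    (contDiff_cut.mul (contDiff_Gt hε i))

/-- `∂V` is smooth. [folklore] -/
theorem contDiff_dV (hε : ε ≠ 0) (k i : Fin 3) : ContDiff ℝ ∞ (dV ε j k i) :=
  ((ContDiff.sum fun l _ => ((contDiff_ddcut k l).mul (contDiff_tau hε l i)).add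
    ((contDiff_dcut l).mul (contDiff_dtau hε k l i))).add ((contDiff_dcut k).mul (contDiff_Gt hε i))).add
    (contDiff_cut.mul (contDiff_dGt hε k i))

/-- `∑ₖ∂ₖ∂ₖτ` is smooth. [folklore] -/
theorem contDiff_ddtau (hε : ε ≠ 0) (l i : Fin 3) : ContDiff ℝ ∞ (ddtau ε j l i) :=
  (contDiff_const.mul (contDiff_E1 hε i)).sub (contDiff_const.mul (contDiff_E1 hε l))

/-- `R` is smooth. [folklore] -/
theorem contDiff_R (hε : ε ≠ 0) (i : Fin 3) : ContDiff ℝ ∞ (R ε j i) := by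
  unfold R
  refine ((ContDiff.sum fun l _ => ?_).add ((ContDiff.sum fun k _ => contDiff_ddcut k k).mul
    (contDiff_Gt hε i))).add (contDiff_const.mul (ContDiff.sum fun k _ =>
    (contDiff_dcut k).mul (contDiff_dGt hε k i)))
  exact (((ContDiff.sum fun k _ => contDiff_dddcut k k l).mul (contDiff_tau hε l i)).add
    (contDiff_const.mul (ContDiff.sum fun k _ => (contDiff_ddcut k l).mul (contDiff_dtau hε k l i)))).add
    ((contDiff_dcut l).mul (contDiff_ddtau hε l i))

/-! The chain of derivatives. -/

/-- `∂ₖτₗᵢ = dtau k l i`. [folklore] -/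
theorem pderiv_tau (hε : ε ≠ 0) (k l i : Fin 3) : pderiv k (tau ε j l i) = dtau ε j k l i := by
  have hd := fun i => (contDiff_D1 hε i (n := ∞)).differentiable (by simp)
  unfold tau dtau
  rw [pderiv_sub ((hd i).const_mul _) ((hd l).const_mul _), pderiv_const_mul (hd i),
    pderiv_const_mul (hd l), pderiv_D1 hε, pderiv_D1 hε]

/-- `∑ₖ ∂ₖ(dtau k l i) = ddtau l i`. [folklore] -/
theorem sum_pderiv_dtau (hε : ε ≠ 0) (l i : Fin 3) (x : 𝔼) :
    ∑ k, pderiv k (dtau ε j k l i) x = ddtau ε j l i x := by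
  have hd := fun k i => (contDiff_D2 hε k i (n := ∞)).differentiable (by simp)
  have e : ∀ k, pderiv k (dtau ε j k l i) = fun x => kd l j * D3 ε k k i x - kd i j * D3 ε k k l x := by
    intro k
    unfold dtau
    rw [pderiv_sub ((hd k i).const_mul _) ((hd k l).const_mul _), pderiv_const_mul (hd k i),
      pderiv_const_mul (hd k l), pderiv_D2 hε, pderiv_D2 hε]
  simp_rw [e]
  rw [Finset.sum_sub_distrib, ← Finset.mul_sum, ← Finset.mul_sum, sum_D3_diag, sum_D3_diag]
  rfl

/-- `∂ₖGᵢⱼ = dGt k i`. [folklore] -/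
theorem pderiv_Gt (hε : ε ≠ 0) (k i : Fin 3) : pderiv k (Gt ε j i) = dGt ε j k i := by
  have hd2 := (contDiff_D2 hε j i (n := ∞)).differentiable (by simp)
  have hdL := (contDiff_Lap hε (n := ∞)).differentiable (by simp)
  unfold Gt dGt
  rw [pderiv_sub hd2 (hdL.const_mul _), pderiv_const_mul hdL, pderiv_D2 hε, pderiv_Lap hε]

/-- **Commuting derivatives**: `∑ₖ ∂ₖ(D3 k j i) = ∑ₖ ∂ₖ∂ₖ∂ⱼ∂ᵢΦ_ε = ∂ᵢ∂ⱼΔΦ_ε = E2 i j`. [folklore] -/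
theorem sum_pderiv_D3 (hε : ε ≠ 0) (j i : Fin 3) (x : 𝔼) : ∑ k, pderiv k (D3 ε k j i) x = E2 ε i j x := by
  have hΦ : ContDiff ℝ ∞ (Phi ε) := contDiff_Phi hε
  have e1 : ∀ k, D3 ε k j i = pderiv k (pderiv j (pderiv i (Phi ε))) := by
    intro k; rw [pderiv_Phi hε, pderiv_D1 hε, pderiv_D2 hε]
  have e2 : ∀ k, pderiv k (D3 ε k j i) = pderiv j (pderiv i (pderiv k (pderiv k (Phi ε)))) := by
    intro k
    rw [e1 k, pderiv_comm (contDiff_pderiv hΦ i) k j,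
      pderiv_comm (contDiff_pderiv (contDiff_pderiv hΦ i) k) k j, pderiv_comm hΦ k i,
      pderiv_comm (contDiff_pderiv hΦ k) k i]
  simp_rw [e2]
  have hd : ∀ k, Differentiable ℝ (pderiv k (pderiv k (Phi ε))) := fun k =>
    (contDiff_pderiv (contDiff_pderiv hΦ k) k).differentiable (by simp)
  have hd' : ∀ k, Differentiable ℝ (pderiv i (pderiv k (pderiv k (Phi ε)))) := fun k =>
    (contDiff_pderiv (contDiff_pderiv (contDiff_pderiv hΦ k) k) i).differentiable (by simp)
  have l1 : pderiv i (fun x => ∑ k, pderiv k (pderiv k (Phi ε)) x) =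
      fun x => ∑ k, pderiv i (pderiv k (pderiv k (Phi ε))) x := pderiv_sum _ (fun k _ => hd k) i
  have l2 : pderiv j (fun x => ∑ k, pderiv i (pderiv k (pderiv k (Phi ε))) x) =
      fun x => ∑ k, pderiv j (pderiv i (pderiv k (pderiv k (Phi ε)))) x :=
    pderiv_sum _ (fun k _ => hd' k) j
  have hsum : (fun x => ∑ k, pderiv k (pderiv k (Phi ε)) x) = Lap ε := by
    funext x
    rw [← sum_D2_diag]
    refine Finset.sum_congr rfl fun k _ => ?_
    rw [pderiv_Phi hε, pderiv_D1 hε]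
  have := congrFun l2 x
  rw [← this, ← l1, hsum, pderiv_Lap hε, pderiv_E1 hε, E2_comm]

/-- `∑ₖ ∂ₖ(dGt k i) = E2 i j − δᵢⱼ Ψ_ε`. [folklore] -/
theorem sum_pderiv_dGt (hε : ε ≠ 0) (i : Fin 3) (x : 𝔼) :
    ∑ k, pderiv k (dGt ε j k i) x = E2 ε i j x - kd i j * Psi ε x := by
  have hd3 := fun k => (contDiff_D3 hε k j i (n := ∞)).differentiable (by simp)
  have hdE := fun k => (contDiff_E1 hε k (n := ∞)).differentiable (by simp)
  have e : ∀ k, pderiv k (dGt ε j k i) = fun x => pderiv k (D3 ε k j i) x - kd i j * E2 ε k k x := by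
    intro k
    unfold dGt
    rw [pderiv_sub (hd3 k) ((hdE k).const_mul _), pderiv_const_mul (hdE k), pderiv_E1 hε]
  simp_rw [e]
  rw [Finset.sum_sub_distrib, ← Finset.mul_sum, sum_pderiv_D3 hε, sum_E2_diag]

/-- `∂ₖVᵢ = dV k i`. [folklore] -/
theorem pderiv_V (hε : ε ≠ 0) (k i : Fin 3) : pderiv k (V ε j i) = dV ε j k i := by
  have hdc : Differentiable ℝ cut := contDiff_cut.differentiable (by simp)
  have hdd : ∀ l, Differentiable ℝ (dcut l) := fun l => (contDiff_dcut l).differentiable (by simp)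
  have hdt : ∀ l, Differentiable ℝ (tau ε j l i) := fun l => (contDiff_tau hε l i).differentiable (by simp)
  have hdG : Differentiable ℝ (Gt ε j i) := (contDiff_Gt hε i).differentiable (by simp)
  have hs : ∀ l ∈ Finset.univ, Differentiable ℝ (fun x => dcut l x * tau ε j l i x) :=
    fun l _ => (hdd l).mul (hdt l)
  have e1 : pderiv k (fun x => ∑ l, dcut l x * tau ε j l i x) =
      fun x => ∑ l, (ddcut k l x * tau ε j l i x + dcut l x * dtau ε j k l i x) := by
    rw [pderiv_sum _ hs]
    funext x
    refine Finset.sum_congr rfl fun l _ => ?_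
    rw [pderiv_mul (hdd l) (hdt l), pderiv_tau hε]
    rfl
  have e2 : pderiv k (fun x => cut x * Gt ε j i x) = fun x => dcut k x * Gt ε j i x + cut x * dGt ε j k i x := by
    rw [pderiv_mul hdc hdG, pderiv_Gt hε]
    rfl
  unfold V dV
  rw [pderiv_add (Differentiable.fun_sum hs) (hdc.fun_mul hdG), e1, e2]
  funext x
  ring

/-- **The Laplacian of the test field**: `∑ₖ ∂ₖ∂ₖVᵢ = Rᵢ + W (∂ᵢ∂ⱼΔΦ_ε − δᵢⱼ Δ²Φ_ε)`. [folklore] -/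
theorem sum_pderiv_dV (hε : ε ≠ 0) (i : Fin 3) (x : 𝔼) :
    ∑ k, pderiv k (dV ε j k i) x = R ε j i x + cut x * (E2 ε i j x - kd i j * Psi ε x) := by
  have hdc : Differentiable ℝ cut := contDiff_cut.differentiable (by simp)
  have hdd : ∀ l, Differentiable ℝ (dcut l) := fun l => (contDiff_dcut l).differentiable (by simp)
  have hddd : ∀ k l, Differentiable ℝ (ddcut k l) := fun k l => (contDiff_ddcut k l).differentiable (by simp)
  have hdt : ∀ l, Differentiable ℝ (tau ε j l i) := fun l => (contDiff_tau hε l i).differentiable (by simp)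
  have hddt : ∀ k l, Differentiable ℝ (dtau ε j k l i) := fun k l =>
    (contDiff_dtau hε k l i).differentiable (by simp)
  have hdG : Differentiable ℝ (Gt ε j i) := (contDiff_Gt hε i).differentiable (by simp)
  have hddG : ∀ k, Differentiable ℝ (dGt ε j k i) := fun k => (contDiff_dGt hε k i).differentiable (by simp)
  -- derivative of each summand of `dV k i`
  have e : ∀ k, pderiv k (dV ε j k i) = fun x =>
      (∑ l, (dddcut k k l x * tau ε j l i x + ddcut k l x * dtau ε j k l i x +
        (ddcut k l x * dtau ε j k l i x + dcut l x * pderiv k (dtau ε j k l i) x))) +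
      (ddcut k k x * Gt ε j i x + dcut k x * dGt ε j k i x) +
      (dcut k x * dGt ε j k i x + cut x * pderiv k (dGt ε j k i) x) := by
    intro k
    have hs : ∀ l ∈ Finset.univ, Differentiable ℝ
        (fun x => ddcut k l x * tau ε j l i x + dcut l x * dtau ε j k l i x) :=
      fun l _ => ((hddd k l).mul (hdt l)).add ((hdd l).mul (hddt k l))
    have e1 : pderiv k (fun x => ∑ l, (ddcut k l x * tau ε j l i x + dcut l x * dtau ε j k l i x)) =
        fun x => ∑ l, (dddcut k k l x * tau ε j l i x + ddcut k l x * dtau ε j k l i x +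
          (ddcut k l x * dtau ε j k l i x + dcut l x * pderiv k (dtau ε j k l i) x)) := by
      rw [pderiv_sum _ hs]
      funext x
      refine Finset.sum_congr rfl fun l _ => ?_
      rw [pderiv_add ((hddd k l).fun_mul (hdt l)) ((hdd l).fun_mul (hddt k l)), pderiv_mul (hddd k l) (hdt l),
        pderiv_mul (hdd l) (hddt k l), pderiv_tau hε]
      rfl
    have e2 : pderiv k (fun x => dcut k x * Gt ε j i x) =
        fun x => ddcut k k x * Gt ε j i x + dcut k x * dGt ε j k i x := by
      rw [pderiv_mul (hdd k) hdG, pderiv_Gt hε]; rfl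
    have e3 : pderiv k (fun x => cut x * dGt ε j k i x) =
        fun x => dcut k x * dGt ε j k i x + cut x * pderiv k (dGt ε j k i) x := by
      rw [pderiv_mul hdc (hddG k)]; rfl
    unfold dV
    rw [pderiv_add ((Differentiable.fun_sum hs).fun_add ((hdd k).fun_mul hdG)) (hdc.fun_mul (hddG k)),
      pderiv_add (Differentiable.fun_sum hs) ((hdd k).fun_mul hdG), e1, e2, e3]
  simp_rw [e]
  -- collect: expand all sums over `Fin 3` and use the two trace identities
  have hT : ∀ l, ∑ k, pderiv k (dtau ε j k l i) x = ddtau ε j l i x := fun l => sum_pderiv_dtau hε l i x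
  have hG : ∑ k, pderiv k (dGt ε j k i) x = E2 ε i j x - kd i j * Psi ε x := sum_pderiv_dGt hε i x
  have hT0 := hT 0
  have hT1 := hT 1
  have hT2 := hT 2
  simp only [Fin.sum_univ_three] at hT0 hT1 hT2 hG ⊢
  simp only [R, Fin.sum_univ_three]
  linear_combination dcut 0 x * hT0 + dcut 1 x * hT1 + dcut 2 x * hT2 + cut x * hG

/-- `∑ᵢ δᵢⱼ fᵢ = fⱼ`. [folklore] -/
theorem sum_kd_mul (j : Fin 3) (f : Fin 3 → ℝ) : ∑ i, kd i j * f i = f j := by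
  simp only [kd, ite_mul, one_mul, zero_mul, Finset.sum_ite_eq', Finset.mem_univ, if_true]

/-- `τ` is antisymmetric. [folklore] -/
theorem tau_antisymm (l i : Fin 3) (x : 𝔼) : tau ε j l i x = -tau ε j i l x := by
  simp only [tau]; ring

/-- `∑ᵢ D3 i j i = ∂ⱼΔΦ_ε` (the explicit third derivatives are symmetric). [folklore] -/
theorem sum_D3_mid (x : 𝔼) : ∑ i, D3 ε i j i x = E1 ε j x := by
  rw [← sum_D3_diag x j]
  refine Finset.sum_congr rfl fun i _ => ?_
  simp only [D3, kd_comm]; ring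

/-- **The test field is divergence free**: `∑ᵢ ∂ᵢVᵢ = 0`. [folklore] -/
theorem sum_pderiv_V (hε : ε ≠ 0) (x : 𝔼) : ∑ i, pderiv i (V ε j i) x = 0 := by
  simp_rw [pderiv_V hε]
  simp only [dV, Finset.sum_add_distrib]
  -- (a) symmetric times antisymmetric
  have ha : ∑ i, ∑ l, ddcut i l x * tau ε j l i x = 0 := by
    have h1 : ∑ i, ∑ l, ddcut i l x * tau ε j l i x = -∑ i, ∑ l, ddcut i l x * tau ε j l i x := by
      conv_lhs => rw [Finset.sum_comm]
      rw [← Finset.sum_neg_distrib]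
      refine Finset.sum_congr rfl fun i _ => ?_
      rw [← Finset.sum_neg_distrib]
      refine Finset.sum_congr rfl fun l _ => ?_
      rw [ddcut_comm l i, tau_antisymm i l]
      ring
    linarith
  -- (b) + (c)
  have hb : ∀ l, ∑ i, dtau ε j i l i x = kd l j * Lap ε x - D2 ε j l x := by
    intro l
    simp only [dtau, Finset.sum_sub_distrib, ← Finset.mul_sum, sum_D2_diag]
    rw [sum_kd_mul j (fun i => D2 ε i l x), D2_comm]
  have hbc : ∑ i, ∑ l, dcut l x * dtau ε j i l i x + ∑ i, dcut i x * Gt ε j i x = 0 := by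
    rw [Finset.sum_comm]
    simp_rw [← Finset.mul_sum, hb]
    simp only [Gt, mul_sub, Finset.sum_sub_distrib]
    have e1 : ∑ l, dcut l x * (kd l j * Lap ε x) = dcut j x * Lap ε x := by
      rw [← sum_kd_mul j (fun l => dcut l x * Lap ε x)]
      refine Finset.sum_congr rfl fun l _ => by ring
    rw [e1]
    ring
  -- (d)
  have hd : ∑ i, cut x * dGt ε j i i x = 0 := by
    rw [← Finset.mul_sum]
    simp only [dGt, Finset.sum_sub_distrib, sum_D3_mid, sum_kd_mul j (fun i => E1 ε i x), sub_self,
      mul_zero]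
  rw [ha, hd]
  linarith [hbc]

/-! ### Pointwise bounds, uniform in `ε ≠ 0` -/

/-- `|τₗᵢ| ≤ 2`. [folklore] -/
theorem abs_tau_le (hε : ε ≠ 0) (l i : Fin 3) (x : 𝔼) : |tau ε j l i x| ≤ 2 := by
  unfold tau
  have h1 : |kd l j * D1 ε i x| ≤ 1 := by
    rw [abs_mul]; exact mul_le_one₀ (abs_kd_le_one _ _) (abs_nonneg _) (abs_D1_le hε i x)
  have h2 : |kd i j * D1 ε l x| ≤ 1 := by
    rw [abs_mul]; exact mul_le_one₀ (abs_kd_le_one _ _) (abs_nonneg _) (abs_D1_le hε l x)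
  calc _ ≤ |kd l j * D1 ε i x| + |kd i j * D1 ε l x| := abs_sub _ _
    _ ≤ 1 + 1 := add_le_add h1 h2
    _ = 2 := by norm_num

/-- `|∂ₖτₗᵢ| ≤ 4/‖x‖`. [folklore] -/
theorem abs_dtau_le (hε : ε ≠ 0) (k l i : Fin 3) {x : 𝔼} (hx : x ≠ 0) : |dtau ε j k l i x| ≤ 4 / ‖x‖ := by
  unfold dtau
  have hx0 := norm_pos_iff.2 hx
  have h1 : |kd l j * D2 ε k i x| ≤ 2 / ‖x‖ := by
    rw [abs_mul]
    exact (mul_le_mul (abs_kd_le_one _ _) (abs_D2_le hε k i hx) (abs_nonneg _) zero_le_one).trans (by simp)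
  have h2 : |kd i j * D2 ε k l x| ≤ 2 / ‖x‖ := by
    rw [abs_mul]
    exact (mul_le_mul (abs_kd_le_one _ _) (abs_D2_le hε k l hx) (abs_nonneg _) zero_le_one).trans (by simp)
  calc _ ≤ |kd l j * D2 ε k i x| + |kd i j * D2 ε k l x| := abs_sub _ _
    _ ≤ 2 / ‖x‖ + 2 / ‖x‖ := add_le_add h1 h2
    _ = 4 / ‖x‖ := by ring

/-- `|∑ₖ∂ₖ∂ₖτₗᵢ| ≤ 10/‖x‖²`. [folklore] -/
theorem abs_ddtau_le (hε : ε ≠ 0) (l i : Fin 3) {x : 𝔼} (hx : x ≠ 0) : |ddtau ε j l i x| ≤ 10 / ‖x‖ ^ 2 := by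
  unfold ddtau
  have h1 : |kd l j * E1 ε i x| ≤ 5 / ‖x‖ ^ 2 := by
    rw [abs_mul]
    exact (mul_le_mul (abs_kd_le_one _ _) (abs_E1_le hε i hx) (abs_nonneg _) zero_le_one).trans (by simp)
  have h2 : |kd i j * E1 ε l x| ≤ 5 / ‖x‖ ^ 2 := by
    rw [abs_mul]
    exact (mul_le_mul (abs_kd_le_one _ _) (abs_E1_le hε l hx) (abs_nonneg _) zero_le_one).trans (by simp)
  calc _ ≤ |kd l j * E1 ε i x| + |kd i j * E1 ε l x| := abs_sub _ _
    _ ≤ 5 / ‖x‖ ^ 2 + 5 / ‖x‖ ^ 2 := add_le_add h1 h2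
    _ = 10 / ‖x‖ ^ 2 := by ring

/-- `|Gᵢⱼ| ≤ 5/‖x‖`. [folklore] -/
theorem abs_Gt_le (hε : ε ≠ 0) (i : Fin 3) {x : 𝔼} (hx : x ≠ 0) : |Gt ε j i x| ≤ 5 / ‖x‖ := by
  unfold Gt
  have h2 : |kd i j * Lap ε x| ≤ 3 / ‖x‖ := by
    rw [abs_mul]
    exact (mul_le_mul (abs_kd_le_one _ _) (abs_Lap_le hε hx) (abs_nonneg _) zero_le_one).trans (by simp)
  calc _ ≤ |D2 ε j i x| + |kd i j * Lap ε x| := abs_sub _ _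
    _ ≤ 2 / ‖x‖ + 3 / ‖x‖ := add_le_add (abs_D2_le hε j i hx) h2
    _ = 5 / ‖x‖ := by ring

/-- `|∂ₖGᵢⱼ| ≤ 11/‖x‖²`. [folklore] -/
theorem abs_dGt_le (hε : ε ≠ 0) (k i : Fin 3) {x : 𝔼} (hx : x ≠ 0) : |dGt ε j k i x| ≤ 11 / ‖x‖ ^ 2 := by
  unfold dGt
  have h2 : |kd i j * E1 ε k x| ≤ 5 / ‖x‖ ^ 2 := by
    rw [abs_mul]
    exact (mul_le_mul (abs_kd_le_one _ _) (abs_E1_le hε k hx) (abs_nonneg _) zero_le_one).trans (by simp)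
  calc _ ≤ |D3 ε k j i x| + |kd i j * E1 ε k x| := abs_sub _ _
    _ ≤ 6 / ‖x‖ ^ 2 + 5 / ‖x‖ ^ 2 := add_le_add (abs_D3_le hε k j i hx) h2
    _ = 11 / ‖x‖ ^ 2 := by ring

/-- The truncated Riesz kernel `k(x) = ‖x‖⁻² 1_{‖x‖ ≤ 1}` that dominates the test field. [folklore] -/
def ker (x : 𝔼) : ℝ := if ‖x‖ ≤ 1 then (‖x‖ ^ 2)⁻¹ else 0

/-- `k ≥ 0`. [folklore] -/
theorem ker_nonneg (x : 𝔼) : 0 ≤ ker x := by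
  unfold ker; split_ifs <;> positivity

/-- On the punctured closed unit ball, `1 ≤ k(x)`, `1/‖x‖ ≤ k(x)` and `1/‖x‖² = k(x)`. [folklore] -/
theorem ker_eq {x : 𝔼} (hx1 : ‖x‖ ≤ 1) : ker x = (‖x‖ ^ 2)⁻¹ := by simp [ker, hx1]

/-- `k(x) = 0` for `‖x‖ > 1`. [folklore] -/
theorem ker_eq_zero {x : 𝔼} (hx1 : 1 < ‖x‖) : ker x = 0 := by simp [ker, not_le.2 hx1]

/-- `1 ≤ k(x)` for `0 < ‖x‖ ≤ 1`. [folklore] -/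
theorem one_le_ker {x : 𝔼} (hx : x ≠ 0) (hx1 : ‖x‖ ≤ 1) : 1 ≤ ker x := by
  rw [ker_eq hx1, one_le_inv_iff₀]
  exact ⟨by positivity, by nlinarith [norm_nonneg x]⟩

/-- `1/‖x‖ ≤ k(x)` for `0 < ‖x‖ ≤ 1`. [folklore] -/
theorem inv_norm_le_ker {x : 𝔼} (hx : x ≠ 0) (hx1 : ‖x‖ ≤ 1) : 1 / ‖x‖ ≤ ker x := by
  have hx0 := norm_pos_iff.2 hx
  rw [ker_eq hx1, div_le_iff₀ hx0]
  rw [show (‖x‖ ^ 2)⁻¹ * ‖x‖ = 1 / ‖x‖ by field_simp]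
  rw [le_div_iff₀ hx0]
  linarith

/-- `1/‖x‖² ≤ k(x)` for `0 < ‖x‖ ≤ 1` (an equality). [folklore] -/
theorem inv_norm_sq_le_ker {x : 𝔼} (hx1 : ‖x‖ ≤ 1) : 1 / ‖x‖ ^ 2 ≤ ker x := by
  rw [ker_eq hx1, one_div]

/-- All structure functions of the test field vanish off the closed unit ball: `V`, `∂V`, `R`, and
`∂W`. [folklore] -/
theorem V_eq_zero_of_one_lt (i : Fin 3) {x : 𝔼} (hx : 1 < ‖x‖) : V ε j i x = 0 := by
  simp [V, dcut_eq_zero _ (mem_flatSet_of_gt hx), cut_eq_zero hx.le]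

/-- `∂V = 0` off the closed unit ball. [folklore] -/
theorem dV_eq_zero_of_one_lt (k i : Fin 3) {x : 𝔼} (hx : 1 < ‖x‖) : dV ε j k i x = 0 := by
  simp [dV, dcut_eq_zero _ (mem_flatSet_of_gt hx), ddcut_eq_zero _ _ (mem_flatSet_of_gt hx),
    cut_eq_zero hx.le]

/-- `R = 0` on `flatSet` (no derivative of `W` survives). [folklore] -/
theorem R_eq_zero_of_mem (i : Fin 3) {x : 𝔼} (hx : x ∈ flatSet) : R ε j i x = 0 := by
  simp [R, dcut_eq_zero _ hx, ddcut_eq_zero _ _ hx, dddcut_eq_zero _ _ _ hx]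

/-- **Bounds for the test field**: with `M` the bound on the cutoff derivatives, for all `ε ≠ 0`,
`j`, and `x ≠ 0`: `|Vᵢ| ≤ 11M k`, `|∂ₖVᵢ| ≤ 34M k`, `|Rᵢ| ≤ 576M`, `|∂ᵢW · ∂ⱼΔΦ_ε| ≤ 20M`. [folklore] -/
theorem test_field_bounds : ∃ C : ℝ, 0 < C ∧ ∀ ε : ℝ, ε ≠ 0 → ∀ j : Fin 3,
    (∀ i (x : 𝔼), x ≠ 0 → |V ε j i x| ≤ C * ker x) ∧
    (∀ k i (x : 𝔼), x ≠ 0 → |dV ε j k i x| ≤ C * ker x) ∧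
    (∀ i (x : 𝔼), |R ε j i x| ≤ C) ∧
    (∀ i (x : 𝔼), |dcut i x * E1 ε j x| ≤ C) := by
  obtain ⟨M, hM1, hM0, hM1', hM2, hM3⟩ := exists_cut_bound
  have hMpos : 0 < M := by linarith
  refine ⟨576 * M, by positivity, fun ε hε j => ⟨fun i x hx => ?_, fun k i x hx => ?_, fun i x => ?_,
    fun i x => ?_⟩⟩
  · -- `V`
    by_cases hx1 : ‖x‖ ≤ 1
    · have hk1 := one_le_ker hx hx1
      have hk2 := inv_norm_le_ker hx hx1
      have hx0 := norm_pos_iff.2 hx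
      have h1 : |∑ l, dcut l x * tau ε j l i x| ≤ 6 * M := by
        refine (Finset.abs_sum_le_sum_abs _ _).trans ?_
        have : ∀ l ∈ Finset.univ, |dcut l x * tau ε j l i x| ≤ M * 2 := fun l _ => by
          rw [abs_mul]; exact mul_le_mul (hM1' l x) (abs_tau_le hε l i x) (abs_nonneg _) hMpos.le
        refine (Finset.sum_le_sum this).trans ?_
        simp; linarith
      have h2 : |cut x * Gt ε j i x| ≤ M * (5 / ‖x‖) := by
        rw [abs_mul]; exact mul_le_mul (hM0 x) (abs_Gt_le hε i hx) (abs_nonneg _) hMpos.le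
      calc |V ε j i x| ≤ |∑ l, dcut l x * tau ε j l i x| + |cut x * Gt ε j i x| := abs_add_le _ _
        _ ≤ 6 * M + M * (5 / ‖x‖) := add_le_add h1 h2
        _ = 6 * M * 1 + 5 * M * (1 / ‖x‖) := by ring
        _ ≤ 6 * M * ker x + 5 * M * ker x := by gcongr
        _ ≤ 576 * M * ker x := by nlinarith [ker_nonneg x]
    · rw [V_eq_zero_of_one_lt i (not_le.1 hx1), abs_zero]
      exact mul_nonneg (by positivity) (ker_nonneg x)
  · -- `dV`
    by_cases hx1 : ‖x‖ ≤ 1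
    · have hk1 := one_le_ker hx hx1
      have hk2 := inv_norm_le_ker hx hx1
      have hk3 := inv_norm_sq_le_ker hx1
      have hx0 := norm_pos_iff.2 hx
      have h1 : |∑ l, (ddcut k l x * tau ε j l i x + dcut l x * dtau ε j k l i x)| ≤
          6 * M + 12 * M * (1 / ‖x‖) := by
        refine (Finset.abs_sum_le_sum_abs _ _).trans ?_
        have : ∀ l ∈ Finset.univ, |ddcut k l x * tau ε j l i x + dcut l x * dtau ε j k l i x| ≤
            M * 2 + M * (4 / ‖x‖) := fun l _ => by
          refine (abs_add_le _ _).trans (add_le_add ?_ ?_)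
          · rw [abs_mul]; exact mul_le_mul (hM2 k l x) (abs_tau_le hε l i x) (abs_nonneg _) hMpos.le
          · rw [abs_mul]; exact mul_le_mul (hM1' l x) (abs_dtau_le hε k l i hx) (abs_nonneg _) hMpos.le
        refine (Finset.sum_le_sum this).trans ?_
        simp only [Finset.sum_const, Finset.card_univ, Fintype.card_fin, nsmul_eq_mul]
        norm_num; ring_nf; rfl
      have h2 : |dcut k x * Gt ε j i x| ≤ M * (5 / ‖x‖) := by
        rw [abs_mul]; exact mul_le_mul (hM1' k x) (abs_Gt_le hε i hx) (abs_nonneg _) hMpos.le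
      have h3 : |cut x * dGt ε j k i x| ≤ M * (11 / ‖x‖ ^ 2) := by
        rw [abs_mul]; exact mul_le_mul (hM0 x) (abs_dGt_le hε k i hx) (abs_nonneg _) hMpos.le
      calc |dV ε j k i x| ≤ |∑ l, (ddcut k l x * tau ε j l i x + dcut l x * dtau ε j k l i x)| +
            |dcut k x * Gt ε j i x| + |cut x * dGt ε j k i x| := abs_add_three _ _ _
        _ ≤ (6 * M + 12 * M * (1 / ‖x‖)) + M * (5 / ‖x‖) + M * (11 / ‖x‖ ^ 2) :=
            add_le_add (add_le_add h1 h2) h3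
        _ = 6 * M * 1 + 17 * M * (1 / ‖x‖) + 11 * M * (1 / ‖x‖ ^ 2) := by ring
        _ ≤ 6 * M * ker x + 17 * M * ker x + 11 * M * ker x := by gcongr
        _ ≤ 576 * M * ker x := by nlinarith [ker_nonneg x]
    · rw [dV_eq_zero_of_one_lt k i (not_le.1 hx1), abs_zero]
      exact mul_nonneg (by positivity) (ker_nonneg x)
  · -- `R`
    by_cases hx1 : ‖x‖ < 1 / 2
    · rw [R_eq_zero_of_mem i (mem_flatSet_of_lt hx1), abs_zero]; positivity
    · have hx0 : 0 < ‖x‖ := by linarith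
      have hx : x ≠ 0 := norm_pos_iff.1 hx0
      have hi1 : 1 / ‖x‖ ≤ 2 := by rw [div_le_iff₀ hx0]; linarith
      have hi2 : 1 / ‖x‖ ^ 2 ≤ 4 := by rw [div_le_iff₀ (by positivity)]; nlinarith
      have ht := fun l => abs_tau_le hε l i x (j := j)
      have hdt := fun k l => abs_dtau_le hε k l i hx (j := j)
      have hddt := fun l => abs_ddtau_le hε l i hx (j := j)
      have hG := abs_Gt_le hε i hx (j := j)
      have hdG := fun k => abs_dGt_le hε k i hx (j := j)
      -- each of the five groups
      have g1 : ∀ l, |(∑ k, dddcut k k l x) * tau ε j l i x| ≤ 3 * M * 2 := fun l => by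
        rw [abs_mul]
        refine mul_le_mul ?_ (ht l) (abs_nonneg _) (by positivity)
        refine (Finset.abs_sum_le_sum_abs _ _).trans ?_
        refine (Finset.sum_le_sum fun k _ => hM3 k k l x).trans ?_
        simp
      have g2 : ∀ l, |2 * ∑ k, ddcut k l x * dtau ε j k l i x| ≤ 2 * (3 * (M * (4 / ‖x‖))) := fun l => by
        rw [abs_mul, abs_two]
        refine mul_le_mul_of_nonneg_left ?_ (by norm_num)
        refine (Finset.abs_sum_le_sum_abs _ _).trans ?_
        have hb : ∀ k ∈ Finset.univ, |ddcut k l x * dtau ε j k l i x| ≤ M * (4 / ‖x‖) := fun k _ => by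
          rw [abs_mul]; exact mul_le_mul (hM2 k l x) (hdt k l) (abs_nonneg _) hMpos.le
        exact (Finset.sum_le_sum hb).trans (by simp)
      have g3 : ∀ l, |dcut l x * ddtau ε j l i x| ≤ M * (10 / ‖x‖ ^ 2) := fun l => by
        rw [abs_mul]; exact mul_le_mul (hM1' l x) (hddt l) (abs_nonneg _) hMpos.le
      have g4 : |(∑ k, ddcut k k x) * Gt ε j i x| ≤ 3 * M * (5 / ‖x‖) := by
        rw [abs_mul]
        refine mul_le_mul ?_ hG (abs_nonneg _) (by positivity)
        refine (Finset.abs_sum_le_sum_abs _ _).trans ?_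
        refine (Finset.sum_le_sum fun k _ => hM2 k k x).trans ?_
        simp
      have g5 : |2 * ∑ k, dcut k x * dGt ε j k i x| ≤ 2 * (3 * (M * (11 / ‖x‖ ^ 2))) := by
        rw [abs_mul, abs_two]
        refine mul_le_mul_of_nonneg_left ?_ (by norm_num)
        refine (Finset.abs_sum_le_sum_abs _ _).trans ?_
        have hb : ∀ k ∈ Finset.univ, |dcut k x * dGt ε j k i x| ≤ M * (11 / ‖x‖ ^ 2) := fun k _ => by
          rw [abs_mul]; exact mul_le_mul (hM1' k x) (hdG k) (abs_nonneg _) hMpos.le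
        exact (Finset.sum_le_sum hb).trans (by simp)
      have gsum : |∑ l, ((∑ k, dddcut k k l x) * tau ε j l i x + 2 * (∑ k, ddcut k l x * dtau ε j k l i x) +
          dcut l x * ddtau ε j l i x)| ≤ 3 * (3 * M * 2 + 2 * (3 * (M * (4 / ‖x‖))) + M * (10 / ‖x‖ ^ 2)) := by
        refine (Finset.abs_sum_le_sum_abs _ _).trans ?_
        have hb : ∀ l ∈ Finset.univ, |(∑ k, dddcut k k l x) * tau ε j l i x +
            2 * (∑ k, ddcut k l x * dtau ε j k l i x) + dcut l x * ddtau ε j l i x| ≤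
            3 * M * 2 + 2 * (3 * (M * (4 / ‖x‖))) + M * (10 / ‖x‖ ^ 2) := fun l _ =>
          (abs_add_three _ _ _).trans (add_le_add (add_le_add (g1 l) (g2 l)) (g3 l))
        exact (Finset.sum_le_sum hb).trans (le_of_eq (by simp; ring))
      unfold R
      calc _ ≤ _ := abs_add_three _ _ _
        _ ≤ 3 * (3 * M * 2 + 2 * (3 * (M * (4 / ‖x‖))) + M * (10 / ‖x‖ ^ 2)) + 3 * M * (5 / ‖x‖) +
            2 * (3 * (M * (11 / ‖x‖ ^ 2))) := add_le_add (add_le_add gsum g4) g5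
        _ = 18 * M + 87 * M * (1 / ‖x‖) + 96 * M * (1 / ‖x‖ ^ 2) := by ring
        _ ≤ 18 * M + 87 * M * 2 + 96 * M * 4 := by gcongr
        _ = 576 * M := by ring
  · -- `∂ᵢW ∂ⱼΔΦ`
    by_cases hx1 : ‖x‖ < 1 / 2
    · rw [dcut_eq_zero i (mem_flatSet_of_lt hx1), zero_mul, abs_zero]; positivity
    · have hx0 : 0 < ‖x‖ := by linarith
      have hx : x ≠ 0 := norm_pos_iff.1 hx0
      have hi2 : 5 / ‖x‖ ^ 2 ≤ 20 := by rw [div_le_iff₀ (by positivity)]; nlinarith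
      rw [abs_mul]
      calc |dcut i x| * |E1 ε j x| ≤ M * (5 / ‖x‖ ^ 2) :=
            mul_le_mul (hM1' i x) (abs_E1_le hε j hx) (abs_nonneg _) hMpos.le
        _ ≤ M * 20 := by gcongr
        _ ≤ 576 * M := by linarith

/-! ### Kernel-majorant form of the bounds -/

/-- The bounds of `test_field_bounds` in the form used under the integral: off the origin every
structure function is dominated by `C k(x)`. [folklore] -/
theorem test_field_bounds_ker : ∃ C : ℝ, 0 < C ∧ ∀ ε : ℝ, ε ≠ 0 → ∀ j : Fin 3,
    (∀ i (x : 𝔼), x ≠ 0 → |V ε j i x| ≤ C * ker x) ∧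
    (∀ k i (x : 𝔼), x ≠ 0 → |dV ε j k i x| ≤ C * ker x) ∧
    (∀ i (x : 𝔼), x ≠ 0 → |R ε j i x| ≤ C * ker x) ∧
    (∀ i (x : 𝔼), x ≠ 0 → |dcut i x * E1 ε j x| ≤ C * ker x) := by
  obtain ⟨C, hC, hb⟩ := test_field_bounds
  refine ⟨C, hC, fun ε hε j => ⟨(hb ε hε j).1, (hb ε hε j).2.1, fun i x hx => ?_, fun i x hx => ?_⟩⟩
  · by_cases hx1 : ‖x‖ ≤ 1
    · exact ((hb ε hε j).2.2.1 i x).trans (le_mul_of_one_le_right hC.le (one_le_ker hx hx1))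
    · rw [R_eq_zero_of_mem i (mem_flatSet_of_gt (not_le.1 hx1)), abs_zero]
      exact mul_nonneg hC.le (ker_nonneg x)
  · by_cases hx1 : ‖x‖ ≤ 1
    · exact ((hb ε hε j).2.2.2 i x).trans (le_mul_of_one_le_right hC.le (one_le_ker hx hx1))
    · rw [dcut_eq_zero i (mem_flatSet_of_gt (not_le.1 hx1)), zero_mul, abs_zero]
      exact mul_nonneg hC.le (ker_nonneg x)

end TestField

/-! ### Translation, regularity and integration-by-parts bookkeeping -/

section Bookkeeping

/-- `∂ₗ` commutes with translations: `∂ₗ (f(· − y)) = (∂ₗ f)(· − y)`. [folklore] -/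
theorem pderiv_comp_sub_right (f : 𝔼 → ℝ) (y : 𝔼) (l : Fin 3) :
    pderiv l (fun z => f (z - y)) = fun z => pderiv l f (z - y) := by
  funext z
  simp only [pderiv_apply]
  rw [fderiv_comp_sub]

/-- Translates of `Cⁿ` functions are `Cⁿ`. [folklore] -/
theorem contDiff_comp_sub_right {f : 𝔼 → ℝ} {n : WithTop ℕ∞} (hf : ContDiff ℝ n f) (y : 𝔼) :
    ContDiff ℝ n (fun z => f (z - y)) :=
  hf.comp (contDiff_id.sub contDiff_const)

/-- A function vanishing off the closed unit ball has compactly supported translates. [folklore] -/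
theorem hasCompactSupport_comp_sub_right {f : 𝔼 → ℝ} (hf : ∀ x : 𝔼, 1 < ‖x‖ → f x = 0) (y : 𝔼) :
    HasCompactSupport (fun z => f (z - y)) := by
  refine HasCompactSupport.intro (isCompact_closedBall y 1) fun z hz => hf _ ?_
  rw [mem_closedBall, dist_eq_norm, not_le] at hz
  exact hz

/-- `∂ₖ` of a `C^{n+1}` function is `Cⁿ`. [folklore] -/
theorem contDiff_pderiv_of_succ {f : 𝔼 → ℝ} {n : ℕ} (hf : ContDiff ℝ (n + 1) f) (k : Fin 3) :
    ContDiff ℝ n (pderiv k f) := by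
  have h := hf.fderiv_right (m := n) le_rfl
  exact h.clm_apply contDiff_const

variable {ν a : ℝ} {U : 𝔼 → 𝔼} {P : 𝔼 → ℝ}

/-- Components of a Leray profile are `C²`. [folklore] -/
theorem _root_.Literature.Analysis.FluidPDE.IsLerayProfile.contDiff_comp (h : IsLerayProfile ν a U P)
    (i : Fin 3) : ContDiff ℝ 2 (fun z => U z i) :=
  contDiff_comp_euclidean h.contDiff_velocity i

/-- Components of a Leray profile are `C¹`. [folklore] -/
theorem _root_.Literature.Analysis.FluidPDE.IsLerayProfile.contDiff_one_comp (h : IsLerayProfile ν a U P)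
    (i : Fin 3) : ContDiff ℝ 1 (fun z => U z i) :=
  (h.contDiff_comp i).of_le (by norm_num)

/-- First partials of the components of a Leray profile are `C¹`. [folklore] -/
theorem _root_.Literature.Analysis.FluidPDE.IsLerayProfile.contDiff_one_pderiv_comp
    (h : IsLerayProfile ν a U P) (k i : Fin 3) : ContDiff ℝ 1 (pderiv k (fun z => U z i)) :=
  contDiff_pderiv_of_succ (n := 1) (h.contDiff_comp i) k

/-- `|Uᵢ(z)| ≤ ‖U(z)‖`. [folklore] -/
theorem abs_apply_le_norm (U : 𝔼 → 𝔼) (z : 𝔼) (i : Fin 3) : |U z i| ≤ ‖U z‖ := abs_coord_le_norm (U z) i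

/-- `‖v‖ ≤ ∑ᵢ |vᵢ|` on `ℝ³`. [folklore] -/
theorem norm_le_sum_abs (v : 𝔼) : ‖v‖ ≤ ∑ i, |v i| := by
  have h0 : 0 ≤ ∑ i, |v i| := Finset.sum_nonneg fun i _ => abs_nonneg _
  have h : ‖v‖ ^ 2 ≤ (∑ i, |v i|) ^ 2 := by
    rw [EuclideanSpace.real_norm_sq_eq, Fin.sum_univ_three, Fin.sum_univ_three]
    nlinarith [abs_nonneg (v 0), abs_nonneg (v 1), abs_nonneg (v 2), sq_abs (v 0), sq_abs (v 1),
      sq_abs (v 2)]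
  exact (pow_le_pow_iff_left₀ (norm_nonneg _) h0 two_ne_zero).1 h

/-- `continuous × continuous with compact support` is integrable. [folklore] -/
theorem integrable_mul_of_hasCompactSupport_right {f g : 𝔼 → ℝ} (hf : Continuous f) (hg : Continuous g)
    (hgc : HasCompactSupport g) : Integrable (fun z => f z * g z) :=
  (hf.mul hg).integrable_of_hasCompactSupport hgc.mul_left

/-- `continuous with compact support × continuous` is integrable. [folklore] -/
theorem integrable_mul_of_hasCompactSupport_left {f g : 𝔼 → ℝ} (hf : Continuous f) (hfc : HasCompactSupport f)
    (hg : Continuous g) : Integrable (fun z => f z * g z) :=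
  (hf.mul hg).integrable_of_hasCompactSupport hfc.mul_right

end Bookkeeping

/-! ### The translated test field and the five integrations by parts -/

section IBP

variable (ε : ℝ) (j : Fin 3) (y : 𝔼)

/-- The translated test field `Vᵢ(· − y)`. [folklore] -/
def Vt (i : Fin 3) (z : 𝔼) : ℝ := V ε j i (z - y)

/-- `∂ₖVᵢ(· − y)`. [folklore] -/
def dVt (k i : Fin 3) (z : 𝔼) : ℝ := dV ε j k i (z - y)

variable {ε j y}

/-- `V(· − y)` is smooth. [folklore] -/
theorem contDiff_Vt (hε : ε ≠ 0) (i : Fin 3) {n : ℕ∞} : ContDiff ℝ n (Vt ε j y i) :=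
  contDiff_comp_sub_right ((contDiff_V hε i).of_le (mod_cast le_top)) y

/-- `∂V(· − y)` is smooth. [folklore] -/
theorem contDiff_dVt (hε : ε ≠ 0) (k i : Fin 3) {n : ℕ∞} : ContDiff ℝ n (dVt ε j y k i) :=
  contDiff_comp_sub_right ((contDiff_dV hε k i).of_le (mod_cast le_top)) y

/-- `V(· − y)` has compact support. [folklore] -/
theorem hasCompactSupport_Vt (i : Fin 3) : HasCompactSupport (Vt ε j y i) :=
  hasCompactSupport_comp_sub_right (fun _ hx => V_eq_zero_of_one_lt i hx) y

/-- `∂V(· − y)` has compact support. [folklore] -/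
theorem hasCompactSupport_dVt (k i : Fin 3) : HasCompactSupport (dVt ε j y k i) :=
  hasCompactSupport_comp_sub_right (fun _ hx => dV_eq_zero_of_one_lt k i hx) y

/-- `∂ₖ (Vᵢ(· − y)) = (∂ₖVᵢ)(· − y)`. [folklore] -/
theorem pderiv_Vt (hε : ε ≠ 0) (k i : Fin 3) : pderiv k (Vt ε j y i) = dVt ε j y k i := by
  unfold Vt dVt
  rw [pderiv_comp_sub_right, pderiv_V hε]

/-- `∂ₖ(∂ₖVᵢ)` vanishes off the closed unit ball (where `∂ₖVᵢ` vanishes identically). [folklore] -/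
theorem pderiv_dV_eq_zero_of_one_lt (k i : Fin 3) {x : 𝔼} (hx : 1 < ‖x‖) : pderiv k (dV ε j k i) x = 0 := by
  refine pderiv_eq_zero_of_eqOn (S := (closedBall (0 : 𝔼) 1)ᶜ) isClosed_closedBall.isOpen_compl (c := 0)
    (fun z hz => ?_) k ?_
  · exact dV_eq_zero_of_one_lt k i (by simpa using hz)
  · simpa using hx

variable {ν a : ℝ} {U : 𝔼 → 𝔼} {P : 𝔼 → ℝ}

/-- **(A) The viscous term**: two integrations by parts move `∑ₖ∂ₖ∂ₖ` from `Uᵢ` onto the test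
field, whose Laplacian is `Rᵢ + W(∂ᵢ∂ⱼΔΦ_ε − δᵢⱼΨ_ε)`. [folklore] -/
theorem integral_lap_mul_Vt (h : IsLerayProfile ν a U P) (hε : ε ≠ 0) (i : Fin 3) :
    ∫ z, (∑ k, pderiv k (pderiv k (fun w => U w i)) z) * Vt ε j y i z =
      ∫ z, U z i * (R ε j i (z - y) + cut (z - y) * (E2 ε i j (z - y) - kd i j * Psi ε (z - y))) := by
  have hU1 := h.contDiff_one_comp i
  have hdU1 := fun k => h.contDiff_one_pderiv_comp k i
  have hUc : Continuous (fun w => U w i) := hU1.continuous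
  have hddUc : ∀ k, Continuous (pderiv k (pderiv k (fun w => U w i))) := fun k =>
    continuous_pderiv (hdU1 k) one_ne_zero k
  have hV1 : ContDiff ℝ 1 (Vt ε j y i) := contDiff_Vt hε i (n := 1)
  have hVc := hasCompactSupport_Vt (ε := ε) (j := j) (y := y) i
  have hdV1 : ∀ k, ContDiff ℝ 1 (dVt ε j y k i) := fun k => contDiff_dVt hε k i (n := 1)
  have hdVc := fun k => hasCompactSupport_dVt (ε := ε) (j := j) (y := y) k i
  -- one coordinate at a time
  have step : ∀ k, ∫ z, Vt ε j y i z * pderiv k (pderiv k (fun w => U w i)) z =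
      ∫ z, pderiv k (dV ε j k i) (z - y) * U z i := by
    intro k
    rw [integral_mul_pderiv_eq_neg hV1 hVc (hdU1 k) k, pderiv_Vt hε,
      integral_mul_pderiv_eq_neg (hdV1 k) (hdVc k) hU1 k, neg_neg]
    unfold dVt
    rw [pderiv_comp_sub_right]
  have hint1 : ∀ k, Integrable (fun z => Vt ε j y i z * pderiv k (pderiv k (fun w => U w i)) z) :=
    fun k => integrable_mul_of_hasCompactSupport_left hV1.continuous hVc (hddUc k)
  have hint2 : ∀ k, Integrable (fun z => pderiv k (dV ε j k i) (z - y) * U z i) := fun k => by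
    refine integrable_mul_of_hasCompactSupport_left ?_ ?_ hUc
    · exact ((contDiff_pderiv (contDiff_dV hε k i) k).continuous).comp (continuous_id.sub continuous_const)
    · exact hasCompactSupport_comp_sub_right (fun x hx => pderiv_dV_eq_zero_of_one_lt k i hx) y
  calc ∫ z, (∑ k, pderiv k (pderiv k (fun w => U w i)) z) * Vt ε j y i z
      = ∫ z, ∑ k, Vt ε j y i z * pderiv k (pderiv k (fun w => U w i)) z := by
        refine integral_congr_ae (Eventually.of_forall fun z => ?_)
        simp only [Finset.sum_mul]
        exact Finset.sum_congr rfl fun k _ => mul_comm _ _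
    _ = ∑ k, ∫ z, Vt ε j y i z * pderiv k (pderiv k (fun w => U w i)) z :=
        integral_finsetSum _ fun k _ => hint1 k
    _ = ∑ k, ∫ z, pderiv k (dV ε j k i) (z - y) * U z i := Finset.sum_congr rfl fun k _ => step k
    _ = ∫ z, ∑ k, pderiv k (dV ε j k i) (z - y) * U z i := (integral_finsetSum _ fun k _ => hint2 k).symm
    _ = _ := by
        refine integral_congr_ae (Eventually.of_forall fun z => ?_)
        simp only
        rw [← Finset.sum_mul, sum_pderiv_dV hε, mul_comm]

/-- **(B) The pressure term vanishes**: `∑ᵢ ∫ ∂ᵢP Vᵢ(· − y) = −∫ P (div V)(· − y) = 0`. [folklore] -/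
theorem sum_integral_pderiv_pressure_mul_Vt (h : IsLerayProfile ν a U P) (hε : ε ≠ 0) :
    ∑ i, ∫ z, pderiv i P z * Vt ε j y i z = 0 := by
  have hP1 : ContDiff ℝ 1 P := h.contDiff_pressure
  have hV1 : ∀ i, ContDiff ℝ 1 (Vt ε j y i) := fun i => contDiff_Vt hε i (n := 1)
  have hVc := fun i => hasCompactSupport_Vt (ε := ε) (j := j) (y := y) i
  have step : ∀ i, ∫ z, pderiv i P z * Vt ε j y i z = -∫ z, dVt ε j y i i z * P z := by
    intro i
    calc ∫ z, pderiv i P z * Vt ε j y i z = ∫ z, Vt ε j y i z * pderiv i P z :=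
          integral_congr_ae (Eventually.of_forall fun z => mul_comm _ _)
      _ = -∫ z, pderiv i (Vt ε j y i) z * P z := integral_mul_pderiv_eq_neg (hV1 i) (hVc i) hP1 i
      _ = _ := by rw [pderiv_Vt hε]
  have hint : ∀ i, Integrable (fun z => dVt ε j y i i z * P z) := fun i =>
    integrable_mul_of_hasCompactSupport_left (contDiff_dVt hε i i (n := 1)).continuous (hasCompactSupport_dVt i i)
      hP1.continuous
  simp_rw [step]
  rw [Finset.sum_neg_distrib, neg_eq_zero, ← integral_finsetSum _ fun i _ => hint i]
  refine integral_eq_zero_of_ae (Eventually.of_forall fun z => ?_)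
  simp only [Pi.zero_apply]
  rw [← Finset.sum_mul]
  have : ∑ i, dVt ε j y i i z = 0 := by
    unfold dVt
    rw [← sum_pderiv_V hε (z - y) (j := j)]
    exact Finset.sum_congr rfl fun i _ => by rw [pderiv_V hε]
  rw [this, zero_mul]

/-- **(C) The drift term**: `∫ (∑ₗ zₗ ∂ₗUᵢ) Vᵢ(· − y) = −∫ Uᵢ (3 Vᵢ(· − y) + ∑ₗ zₗ ∂ₗVᵢ(· − y))`. [folklore] -/
theorem integral_drift_mul_Vt (h : IsLerayProfile ν a U P) (hε : ε ≠ 0) (i : Fin 3) :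
    ∫ z, (∑ l, z l * pderiv l (fun w => U w i) z) * Vt ε j y i z =
      -∫ z, U z i * (3 * Vt ε j y i z + ∑ l, z l * dVt ε j y l i z) := by
  have hU1 := h.contDiff_one_comp i
  have hUc : Continuous (fun w => U w i) := hU1.continuous
  have hdUc : ∀ l, Continuous (pderiv l (fun w => U w i)) := fun l => continuous_pderiv hU1 one_ne_zero l
  have hV1 : ContDiff ℝ 1 (Vt ε j y i) := contDiff_Vt hε i (n := 1)
  have hVc := hasCompactSupport_Vt (ε := ε) (j := j) (y := y) i
  have hdV1 : ∀ l, ContDiff ℝ 1 (dVt ε j y l i) := fun l => contDiff_dVt hε l i (n := 1)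
  have hdVc := fun l => hasCompactSupport_dVt (ε := ε) (j := j) (y := y) l i
  have hcoord : ∀ l, ContDiff ℝ 1 (fun z : 𝔼 => z l) := fun l => contDiff_euclideanCoord l
  -- the test functions `z ↦ zₗ Vᵢ(z − y)`
  have hψ1 : ∀ l, ContDiff ℝ 1 (fun z : 𝔼 => z l * Vt ε j y i z) := fun l => (hcoord l).mul hV1
  have hψc : ∀ l, HasCompactSupport (fun z : 𝔼 => z l * Vt ε j y i z) := fun l => hVc.mul_left
  have hdψ : ∀ l, pderiv l (fun z : 𝔼 => z l * Vt ε j y i z) =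
      fun z => Vt ε j y i z + z l * dVt ε j y l i z := by
    intro l
    rw [pderiv_mul (differentiable_euclideanCoord l) (hV1.differentiable one_ne_zero), pderiv_coord,
      pderiv_Vt hε]
    funext z
    simp [kd_self]
  have step : ∀ l, ∫ z, (z l * Vt ε j y i z) * pderiv l (fun w => U w i) z =
      -∫ z, (Vt ε j y i z + z l * dVt ε j y l i z) * U z i := by
    intro l
    rw [integral_mul_pderiv_eq_neg (hψ1 l) (hψc l) hU1 l, hdψ l]
  have hint1 : ∀ l, Integrable (fun z : 𝔼 => (z l * Vt ε j y i z) * pderiv l (fun w => U w i) z) :=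
    fun l => integrable_mul_of_hasCompactSupport_left (hψ1 l).continuous (hψc l) (hdUc l)
  have hint2 : ∀ l, Integrable (fun z : 𝔼 => (Vt ε j y i z + z l * dVt ε j y l i z) * U z i) := by
    intro l
    refine integrable_mul_of_hasCompactSupport_left ?_ ?_ hUc
    · exact hV1.continuous.add ((hcoord l).continuous.mul (hdV1 l).continuous)
    · exact hVc.add (hdVc l).mul_left
  calc ∫ z, (∑ l, z l * pderiv l (fun w => U w i) z) * Vt ε j y i z
      = ∫ z, ∑ l, (z l * Vt ε j y i z) * pderiv l (fun w => U w i) z := by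
        refine integral_congr_ae (Eventually.of_forall fun z => ?_)
        simp only [Finset.sum_mul]
        exact Finset.sum_congr rfl fun l _ => by ring
    _ = ∑ l, ∫ z, (z l * Vt ε j y i z) * pderiv l (fun w => U w i) z :=
        integral_finsetSum _ fun l _ => hint1 l
    _ = ∑ l, -∫ z, (Vt ε j y i z + z l * dVt ε j y l i z) * U z i := Finset.sum_congr rfl fun l _ => step l
    _ = -∫ z, ∑ l, (Vt ε j y i z + z l * dVt ε j y l i z) * U z i := by
        rw [Finset.sum_neg_distrib, integral_finsetSum _ fun l _ => hint2 l]
    _ = _ := by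
        congr 1
        refine integral_congr_ae (Eventually.of_forall fun z => ?_)
        simp only [add_mul, Finset.sum_add_distrib, Finset.sum_const, Finset.card_univ,
          Fintype.card_fin, nsmul_eq_mul, Nat.cast_ofNat]
        rw [mul_add, Finset.mul_sum]
        congr 1
        · ring
        · exact Finset.sum_congr rfl fun l _ => by ring

/-- **(D) The convection term**: `∫ (∑ₗ Uₗ ∂ₗUᵢ) Vᵢ(· − y) = −∫ Uᵢ ∑ₗ Uₗ ∂ₗVᵢ(· − y)` (one integration
by parts and `div U = 0`). [folklore] -/
theorem integral_convect_mul_Vt (h : IsLerayProfile ν a U P) (hε : ε ≠ 0) (i : Fin 3) :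
    ∫ z, (∑ l, U z l * pderiv l (fun w => U w i) z) * Vt ε j y i z =
      -∫ z, U z i * ∑ l, U z l * dVt ε j y l i z := by
  have hU1 := fun l => h.contDiff_one_comp l
  have hUc : ∀ l, Continuous (fun w => U w l) := fun l => (hU1 l).continuous
  have hdUc : ∀ l k, Continuous (pderiv l (fun w => U w k)) := fun l k =>
    continuous_pderiv (hU1 k) one_ne_zero l
  have hV1 : ContDiff ℝ 1 (Vt ε j y i) := contDiff_Vt hε i (n := 1)
  have hVc := hasCompactSupport_Vt (ε := ε) (j := j) (y := y) i
  have hdV1 : ∀ l, ContDiff ℝ 1 (dVt ε j y l i) := fun l => contDiff_dVt hε l i (n := 1)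
  have hdVc := fun l => hasCompactSupport_dVt (ε := ε) (j := j) (y := y) l i
  have hψ1 : ∀ l, ContDiff ℝ 1 (fun z => U z l * Vt ε j y i z) := fun l => (hU1 l).mul hV1
  have hψc : ∀ l, HasCompactSupport (fun z => U z l * Vt ε j y i z) := fun l => hVc.mul_left
  have hdψ : ∀ l, pderiv l (fun z => U z l * Vt ε j y i z) =
      fun z => pderiv l (fun w => U w l) z * Vt ε j y i z + U z l * dVt ε j y l i z := by
    intro l
    rw [pderiv_mul ((hU1 l).differentiable one_ne_zero) (hV1.differentiable one_ne_zero), pderiv_Vt hε]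
  have step : ∀ l, ∫ z, (U z l * Vt ε j y i z) * pderiv l (fun w => U w i) z =
      -∫ z, (pderiv l (fun w => U w l) z * Vt ε j y i z + U z l * dVt ε j y l i z) * U z i := by
    intro l
    rw [integral_mul_pderiv_eq_neg (hψ1 l) (hψc l) (hU1 i) l, hdψ l]
  have hint1 : ∀ l, Integrable (fun z => (U z l * Vt ε j y i z) * pderiv l (fun w => U w i) z) :=
    fun l => integrable_mul_of_hasCompactSupport_left (hψ1 l).continuous (hψc l) (hdUc l i)
  have hint2 : ∀ l, Integrable
      (fun z => (pderiv l (fun w => U w l) z * Vt ε j y i z + U z l * dVt ε j y l i z) * U z i) := by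
    intro l
    refine integrable_mul_of_hasCompactSupport_left ?_ ?_ (hUc i)
    · exact ((hdUc l l).mul hV1.continuous).add ((hUc l).mul (hdV1 l).continuous)
    · exact hVc.mul_left.add (hdVc l).mul_left
  have hdiv : ∀ z, ∑ l, pderiv l (fun w => U w l) z = 0 := h.sum_pderiv_comp_eq_zero
  calc ∫ z, (∑ l, U z l * pderiv l (fun w => U w i) z) * Vt ε j y i z
      = ∫ z, ∑ l, (U z l * Vt ε j y i z) * pderiv l (fun w => U w i) z := by
        refine integral_congr_ae (Eventually.of_forall fun z => ?_)
        simp only [Finset.sum_mul]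
        exact Finset.sum_congr rfl fun l _ => by ring
    _ = ∑ l, ∫ z, (U z l * Vt ε j y i z) * pderiv l (fun w => U w i) z :=
        integral_finsetSum _ fun l _ => hint1 l
    _ = ∑ l, -∫ z, (pderiv l (fun w => U w l) z * Vt ε j y i z + U z l * dVt ε j y l i z) * U z i :=
        Finset.sum_congr rfl fun l _ => step l
    _ = -∫ z, ∑ l, (pderiv l (fun w => U w l) z * Vt ε j y i z + U z l * dVt ε j y l i z) * U z i := by
        rw [Finset.sum_neg_distrib, integral_finsetSum _ fun l _ => hint2 l]
    _ = _ := by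
        congr 1
        refine integral_congr_ae (Eventually.of_forall fun z => ?_)
        simp only [add_mul, Finset.sum_add_distrib]
        have e1 : ∑ l, pderiv l (fun w => U w l) z * Vt ε j y i z * U z i = 0 := by
          rw [← Finset.sum_mul, ← Finset.sum_mul, hdiv z, zero_mul, zero_mul]
        rw [e1, zero_add, Finset.mul_sum]
        exact Finset.sum_congr rfl fun l _ => by ring

/-- **(E) The Stokeslet-pressure term**: `∑ᵢ ∫ Uᵢ W(·−y) ∂ᵢ∂ⱼΔΦ_ε(·−y) = −∫ (∑ᵢ Uᵢ ∂ᵢW(·−y)) ∂ⱼΔΦ_ε(·−y)`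
(one integration by parts and `div U = 0`). [folklore] -/
theorem sum_integral_mul_cut_E2 (h : IsLerayProfile ν a U P) (hε : ε ≠ 0) :
    ∑ i, ∫ z, U z i * (cut (z - y) * E2 ε i j (z - y)) =
      -∫ z, (∑ i, U z i * dcut i (z - y)) * E1 ε j (z - y) := by
  have hU1 := fun l => h.contDiff_one_comp l
  have hUc : ∀ l, Continuous (fun w => U w l) := fun l => (hU1 l).continuous
  have hdUc : ∀ l k, Continuous (pderiv l (fun w => U w k)) := fun l k =>
    continuous_pderiv (hU1 k) one_ne_zero l
  have hcut1 : ContDiff ℝ 1 (fun z : 𝔼 => cut (z - y)) :=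
    contDiff_comp_sub_right (contDiff_cut.of_le (mod_cast le_top)) y
  have hcutc : HasCompactSupport (fun z : 𝔼 => cut (z - y)) :=
    hasCompactSupport_comp_sub_right (fun x hx => cut_eq_zero hx.le) y
  have hdcutc : ∀ i, Continuous (fun z : 𝔼 => dcut i (z - y)) := fun i =>
    (contDiff_dcut i).continuous.comp (continuous_id.sub continuous_const)
  have hE1 : ContDiff ℝ 1 (fun z : 𝔼 => E1 ε j (z - y)) := contDiff_comp_sub_right (contDiff_E1 hε j) y
  have hpE1 : ∀ i, pderiv i (fun z : 𝔼 => E1 ε j (z - y)) = fun z => E2 ε i j (z - y) := by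
    intro i; rw [pderiv_comp_sub_right, pderiv_E1 hε]
  have hpcut : ∀ i, pderiv i (fun z : 𝔼 => cut (z - y)) = fun z => dcut i (z - y) := by
    intro i; rw [pderiv_comp_sub_right]; rfl
  have hψ1 : ∀ i, ContDiff ℝ 1 (fun z => U z i * cut (z - y)) := fun i => (hU1 i).mul hcut1
  have hψc : ∀ i, HasCompactSupport (fun z => U z i * cut (z - y)) := fun i => hcutc.mul_left
  have hdψ : ∀ i, pderiv i (fun z => U z i * cut (z - y)) =
      fun z => pderiv i (fun w => U w i) z * cut (z - y) + U z i * dcut i (z - y) := by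
    intro i
    rw [pderiv_mul ((hU1 i).differentiable one_ne_zero) (hcut1.differentiable one_ne_zero), hpcut i]
  have step : ∀ i, ∫ z, U z i * (cut (z - y) * E2 ε i j (z - y)) =
      -∫ z, (pderiv i (fun w => U w i) z * cut (z - y) + U z i * dcut i (z - y)) * E1 ε j (z - y) := by
    intro i
    have e : (fun z => U z i * (cut (z - y) * E2 ε i j (z - y))) =
        fun z => (U z i * cut (z - y)) * pderiv i (fun z : 𝔼 => E1 ε j (z - y)) z := by
      funext z; rw [hpE1 i]; ring
    rw [e, integral_mul_pderiv_eq_neg (hψ1 i) (hψc i) hE1 i, hdψ i]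
  have hint : ∀ i, Integrable
      (fun z => (pderiv i (fun w => U w i) z * cut (z - y) + U z i * dcut i (z - y)) * E1 ε j (z - y)) := by
    intro i
    refine integrable_mul_of_hasCompactSupport_left ?_ ?_ hE1.continuous
    · exact ((hdUc i i).mul hcut1.continuous).add ((hUc i).mul (hdcutc i))
    · refine hcutc.mul_left.add ?_
      exact (hasCompactSupport_comp_sub_right (fun x hx => dcut_eq_zero i (mem_flatSet_of_gt hx)) y).mul_left
  have hdiv : ∀ z, ∑ l, pderiv l (fun w => U w l) z = 0 := h.sum_pderiv_comp_eq_zero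
  simp_rw [step]
  rw [Finset.sum_neg_distrib, ← integral_finsetSum _ fun i _ => hint i]
  congr 1
  refine integral_congr_ae (Eventually.of_forall fun z => ?_)
  simp only [add_mul, Finset.sum_add_distrib, Finset.sum_mul]
  have e1 : ∑ i, pderiv i (fun w => U w i) z * cut (z - y) * E1 ε j (z - y) = 0 := by
    rw [← Finset.sum_mul, ← Finset.sum_mul, hdiv z, zero_mul, zero_mul]
  rw [e1, zero_add]

/-- **The master identity.** Testing the profile system (Tsai 1998, (1.3), in the coordinates of
`IsLerayProfile.profile_comp`) against the divergence-free field `V(· − y)` and integrating by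
parts ((A)–(E)): the mollified value `ν ∫ Uⱼ W(·−y) Ψ_ε(·−y)` equals a sum of integrals of `U` and
`U ⊗ U` against the bounded/`|x|⁻²`-singular structure functions of the test field; the pressure
has disappeared. [folklore] -/
theorem integral_cut_Psi_eq (h : IsLerayProfile ν a U P) (hε : ε ≠ 0) :
    ν * (∫ z, U z j * (cut (z - y) * Psi ε (z - y))) =
      ν * (∑ i, ∫ z, U z i * R ε j i (z - y))
      - ν * (∫ z, (∑ i, U z i * dcut i (z - y)) * E1 ε j (z - y))
      - a * (∑ i, ∫ z, U z i * Vt ε j y i z)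
      + a * (∑ i, ∫ z, U z i * (3 * Vt ε j y i z + ∑ l, z l * dVt ε j y l i z))
      + ∑ i, ∫ z, U z i * ∑ l, U z l * dVt ε j y l i z := by
  have hU1 := fun l => h.contDiff_one_comp l
  have hUc : ∀ l, Continuous (fun w => U w l) := fun l => (hU1 l).continuous
  have hdUc : ∀ l k, Continuous (pderiv l (fun w => U w k)) := fun l k =>
    continuous_pderiv (hU1 k) one_ne_zero l
  have hddUc : ∀ k i, Continuous (pderiv k (pderiv k (fun w => U w i))) := fun k i =>
    continuous_pderiv (h.contDiff_one_pderiv_comp k i) one_ne_zero k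
  have hPc : ∀ i, Continuous (pderiv i P) := fun i => continuous_pderiv h.contDiff_pressure one_ne_zero i
  have hVcont : ∀ i, Continuous (Vt ε j y i) := fun i => (contDiff_Vt hε i (n := 1)).continuous
  have hVc := fun i => hasCompactSupport_Vt (ε := ε) (j := j) (y := y) i
  have htr : ∀ {f : 𝔼 → ℝ}, ContDiff ℝ ∞ f → Continuous (fun z : 𝔼 => f (z - y)) := fun hf =>
    hf.continuous.comp (continuous_id.sub continuous_const)
  -- the five integrands, for each `i`
  set f1 : Fin 3 → 𝔼 → ℝ := fun i z => (∑ k, pderiv k (pderiv k (fun w => U w i)) z) * Vt ε j y i z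
  set f2 : Fin 3 → 𝔼 → ℝ := fun i z => U z i * Vt ε j y i z
  set f3 : Fin 3 → 𝔼 → ℝ := fun i z => (∑ l, z l * pderiv l (fun w => U w i) z) * Vt ε j y i z
  set f4 : Fin 3 → 𝔼 → ℝ := fun i z => (∑ l, U z l * pderiv l (fun w => U w i) z) * Vt ε j y i z
  set f5 : Fin 3 → 𝔼 → ℝ := fun i z => pderiv i P z * Vt ε j y i z
  have hi1 : ∀ i, Integrable (f1 i) := fun i =>
    integrable_mul_of_hasCompactSupport_right (continuous_finsetSum _ fun k _ => hddUc k i) (hVcont i) (hVc i)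
  have hi2 : ∀ i, Integrable (f2 i) := fun i =>
    integrable_mul_of_hasCompactSupport_right (hUc i) (hVcont i) (hVc i)
  have hi3 : ∀ i, Integrable (f3 i) := fun i =>
    integrable_mul_of_hasCompactSupport_right
      (continuous_finsetSum _ fun l _ => (continuous_apply l |>.comp (PiLp.continuous_ofLp 2 _)).mul
        (hdUc l i)) (hVcont i) (hVc i)
  have hi4 : ∀ i, Integrable (f4 i) := fun i =>
    integrable_mul_of_hasCompactSupport_right
      (continuous_finsetSum _ fun l _ => (hUc l).mul (hdUc l i)) (hVcont i) (hVc i)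
  have hi5 : ∀ i, Integrable (f5 i) := fun i =>
    integrable_mul_of_hasCompactSupport_right (hPc i) (hVcont i) (hVc i)
  -- the pointwise equation, integrated
  have hpt : ∀ i z, -ν * f1 i z + a * f2 i z + a * f3 i z + f4 i z + f5 i z = 0 := by
    intro i z
    have e := h.profile_comp z i
    simp only [f1, f2, f3, f4, f5]
    have : (-(ν * ∑ k, pderiv k (pderiv k fun w => U w i) z) + a * U z i +
        a * ∑ l, z l * pderiv l (fun w => U w i) z + ∑ l, U z l * pderiv l (fun w => U w i) z +
        pderiv i P z) * Vt ε j y i z = 0 := by rw [e, zero_mul]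
    linear_combination this
  have hint : ∀ i, -ν * (∫ z, f1 i z) + a * (∫ z, f2 i z) + a * (∫ z, f3 i z) + (∫ z, f4 i z) +
      (∫ z, f5 i z) = 0 := by
    intro i
    have e : ∫ z, (-ν * f1 i z + a * f2 i z + a * f3 i z + f4 i z + f5 i z) = 0 := by
      simp only [hpt, integral_zero]
    rw [integral_add, integral_add, integral_add, integral_add, integral_const_mul, integral_const_mul,
      integral_const_mul] at e
    · exact e
    · exact (hi1 i).const_mul _
    · exact (hi2 i).const_mul _
    · exact ((hi1 i).const_mul _).add ((hi2 i).const_mul _)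
    · exact (hi3 i).const_mul _
    · exact (((hi1 i).const_mul _).add ((hi2 i).const_mul _)).add ((hi3 i).const_mul _)
    · exact hi4 i
    · exact ((((hi1 i).const_mul _).add ((hi2 i).const_mul _)).add ((hi3 i).const_mul _)).add (hi4 i)
    · exact hi5 i
  -- substitute (A)
  set IP : Fin 3 → ℝ := fun i => ∫ z, U z i * (cut (z - y) * Psi ε (z - y))
  set IR : Fin 3 → ℝ := fun i => ∫ z, U z i * R ε j i (z - y)
  set IE : Fin 3 → ℝ := fun i => ∫ z, U z i * (cut (z - y) * E2 ε i j (z - y))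
  have hA : ∀ i, ∫ z, f1 i z = IR i + IE i - kd i j * IP i := by
    intro i
    have iR : Integrable (fun z => U z i * R ε j i (z - y)) :=
      integrable_mul_of_hasCompactSupport_right (hUc i) (htr (contDiff_R hε i))
        (hasCompactSupport_comp_sub_right (fun x hx => R_eq_zero_of_mem i (mem_flatSet_of_gt hx)) y)
    have iE : Integrable (fun z => U z i * (cut (z - y) * E2 ε i j (z - y))) :=
      integrable_mul_of_hasCompactSupport_right (hUc i) ((htr contDiff_cut).mul (htr (contDiff_E2 hε i j)))
        ((hasCompactSupport_comp_sub_right (fun x hx => cut_eq_zero hx.le) y).mul_right)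
    have iP : Integrable (fun z => U z i * (cut (z - y) * Psi ε (z - y))) :=
      integrable_mul_of_hasCompactSupport_right (hUc i) ((htr contDiff_cut).mul (htr (contDiff_Psi hε)))
        ((hasCompactSupport_comp_sub_right (fun x hx => cut_eq_zero hx.le) y).mul_right)
    simp only [f1, IR, IE, IP]
    rw [integral_lap_mul_Vt h hε i]
    have e : (fun z => U z i * (R ε j i (z - y) + cut (z - y) * (E2 ε i j (z - y) - kd i j * Psi ε (z - y)))) =
        fun z => U z i * R ε j i (z - y) + U z i * (cut (z - y) * E2 ε i j (z - y)) -
          kd i j * (U z i * (cut (z - y) * Psi ε (z - y))) := by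
      funext z; ring
    rw [e, integral_sub (f := fun z => U z i * R ε j i (z - y) + U z i * (cut (z - y) * E2 ε i j (z - y)))
      (g := fun z => kd i j * (U z i * (cut (z - y) * Psi ε (z - y)))) (iR.add iE) (iP.const_mul _),
      integral_add iR iE, integral_const_mul]
  have hB : ∑ i, ∫ z, f5 i z = 0 := sum_integral_pderiv_pressure_mul_Vt h hε
  have hC : ∀ i, ∫ z, f3 i z = -∫ z, U z i * (3 * Vt ε j y i z + ∑ l, z l * dVt ε j y l i z) :=
    fun i => integral_drift_mul_Vt h hε i
  have hD : ∀ i, ∫ z, f4 i z = -∫ z, U z i * ∑ l, U z l * dVt ε j y l i z :=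
    fun i => integral_convect_mul_Vt h hε i
  have hE : ∑ i, IE i = -∫ z, (∑ i, U z i * dcut i (z - y)) * E1 ε j (z - y) := sum_integral_mul_cut_E2 h hε
  -- per-`i` rearrangement
  have key : ∀ i, ν * (kd i j * IP i) = ν * IR i + ν * IE i - a * (∫ z, f2 i z) +
      a * (∫ z, U z i * (3 * Vt ε j y i z + ∑ l, z l * dVt ε j y l i z)) +
      (∫ z, U z i * ∑ l, U z l * dVt ε j y l i z) - (∫ z, f5 i z) := by
    intro i
    have e := hint i
    rw [hA i, hC i, hD i] at e
    linear_combination e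
  have hkd : ν * IP j = ∑ i, ν * (kd i j * IP i) := by
    rw [← Finset.mul_sum, sum_kd_mul]
  rw [show (ν * ∫ z, U z j * (cut (z - y) * Psi ε (z - y))) = ν * IP j from rfl, hkd,
    Finset.sum_congr rfl fun i _ => key i]
  simp only [Finset.sum_add_distrib, Finset.sum_sub_distrib, ← Finset.mul_sum, hB, hE, f2]
  ring

end IBP

/-! ### The approximate identity and the pointwise bound -/

section Representation

/-- **The mollified value converges**: `∫ Uⱼ(z) W(z−y) Ψ_{1/c}(z−y) dz → M Uⱼ(y)` as `c → ∞`,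
where `M = ∫ Ψ₁ > 0` (`Ψ_ε = ε⁻³ Ψ₁(·/ε)` is an approximate identity, `W(0) = 1`; Mathlib's
`tendsto_integral_comp_smul_smul_of_integrable`). [folklore] -/
theorem tendsto_integral_cut_Psi {U : 𝔼 → 𝔼} (hU : Continuous U) (j : Fin 3) (y : 𝔼) :
    Tendsto (fun c : ℝ => ∫ z, U z j * (cut (z - y) * Psi c⁻¹ (z - y))) atTop
      (𝓝 ((∫ u, Psi 1 u) * U y j)) := by
  set M := ∫ u, Psi 1 u with hM
  have hMpos : 0 < M := integral_Psi_one_pos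
  set φ : 𝔼 → ℝ := fun u => Psi 1 u / M with hφ
  set g : 𝔼 → ℝ := fun x => U (x + y) j * cut x with hg
  have hφ0 : ∀ u, 0 ≤ φ u := fun u => div_nonneg (Psi_pos one_ne_zero u).le hMpos.le
  have hφ1 : ∫ u, φ u = 1 := by
    simp only [hφ]
    rw [integral_div, div_self hMpos.ne']
  have hφd : Tendsto (fun x : 𝔼 => ‖x‖ ^ Module.finrank ℝ 𝔼 * φ x) (Bornology.cobounded 𝔼) (𝓝 0) := by
    have h1 := tendsto_norm_pow_mul_Psi_one.div_const M
    rw [zero_div] at h1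
    refine h1.congr fun x => ?_
    simp only [hφ]
    ring
  have hgc : Continuous g :=
    ((continuous_apply j).comp ((PiLp.continuous_ofLp 2 _).comp
      (hU.comp (continuous_id.add continuous_const)))).mul contDiff_cut.continuous
  have hgi : Integrable g := hgc.integrable_of_hasCompactSupport hasCompactSupport_cut.mul_left
  have hlim := tendsto_integral_comp_smul_smul_of_integrable (μ := (volume : Measure 𝔼)) hφ0 hφ1 hφd hgi
    hgc.continuousAt
  have hg00 : g 0 = U y j := by simp [hg, cut_zero]
  rw [hg00] at hlim
  have hfin : Module.finrank ℝ 𝔼 = 3 := by rw [finrank_euclideanSpace, Fintype.card_fin]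
  refine (hlim.const_mul M).congr' ?_
  filter_upwards [eventually_gt_atTop (0 : ℝ)] with c hc
  have e1 : (fun z => U z j * (cut (z - y) * Psi c⁻¹ (z - y))) =
      fun z => (fun x => U (x + y) j * (cut x * Psi c⁻¹ x)) (z - y) := by
    funext z; simp only [sub_add_cancel]
  rw [e1, integral_sub_right_eq_self (fun x => U (x + y) j * (cut x * Psi c⁻¹ x)) y, ← integral_const_mul]
  refine integral_congr_ae (Eventually.of_forall fun x => ?_)
  simp only [hφ, hg, hfin, smul_eq_mul]
  rw [Psi_scale (inv_pos.2 hc), inv_inv]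
  field_simp

/-- From an `L¹` majorant to a lower Lebesgue integral: if `|f| ≤ c F` a.e. then
`|∫ f| ≤ c ∫⁻ F` in `ℝ≥0∞`. [folklore] -/
theorem ofReal_abs_integral_le {f F : 𝔼 → ℝ} (hf : Integrable f) {c : ℝ} (hc : 0 ≤ c)
    (hF : ∀ᵐ z ∂(volume : Measure 𝔼), |f z| ≤ c * F z) :
    ENNReal.ofReal |∫ z, f z| ≤ ENNReal.ofReal c * ∫⁻ z, ENNReal.ofReal (F z) := by
  calc ENNReal.ofReal |∫ z, f z| ≤ ENNReal.ofReal (∫ z, |f z|) :=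
        ENNReal.ofReal_le_ofReal (abs_integral_le_integral_abs)
    _ = ∫⁻ z, ENNReal.ofReal (|f z|) :=
        ofReal_integral_eq_lintegral_ofReal hf.abs (Eventually.of_forall fun z => abs_nonneg _)
    _ ≤ ∫⁻ z, ENNReal.ofReal c * ENNReal.ofReal (F z) := by
        refine lintegral_mono_ae ?_
        filter_upwards [hF] with z hz
        rw [← ENNReal.ofReal_mul hc]
        exact ENNReal.ofReal_le_ofReal hz
    _ = ENNReal.ofReal c * ∫⁻ z, ENNReal.ofReal (F z) :=
        lintegral_const_mul' _ _ ENNReal.ofReal_ne_top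

/-- Almost every point differs from a given one (Lebesgue measure has no atoms). [folklore] -/
theorem ae_ne (y : 𝔼) : ∀ᵐ z ∂(volume : Measure 𝔼), z ≠ y := by
  have : (volume : Measure 𝔼) {y} = 0 := measure_singleton y
  rw [ae_iff]
  simp only [ne_eq, not_not, setOf_eq_eq_singleton]
  exact this

variable {ν a : ℝ} {U : 𝔼 → 𝔼} {P : 𝔼 → ℝ}

/-- **Pressure-free pointwise bound for Leray profiles.** For a Leray profile `(U, P)` on `ℝ³`
(`U ∈ C²`, `P ∈ C¹`, `−νΔU + aU + a(y·∇)U + (U·∇)U + ∇P = 0`, `div U = 0`; `ν > 0`, `a ≥ 0`)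
there is `C` such that for every `y`,
`|U(y)| ≤ C [ (1 + |y|) ∫_{|z−y|≤1} |U(z)| |z−y|⁻² dz + ∫_{|z−y|≤1} |U(z)|² |z−y|⁻² dz ]`,
stated in `ℝ≥0∞` (no integrability is presupposed). This is the representation-formula step of
Tsai 1998, §3.3 (proof of Lemma 3.3, the estimates of `I₁`–`I₅` at the centre `y = y₀`,
Remark 3.2 (i)), carried out with the compactly supported, exactly divergence-free test field
`∇·(W τ)` built on the regularised Stokeslet instead of the Green tensor of the Stokes system on
a ball: the pressure term vanishes identically and no boundary integrals occur. [folklore] -/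
theorem _root_.Literature.Analysis.FluidPDE.IsLerayProfile.ofReal_norm_le_lintegral_ker
    (h : IsLerayProfile ν a U P) (hν : 0 < ν) (ha : 0 ≤ a) :
    ∃ C : ℝ, 0 < C ∧ ∀ y : 𝔼, ENNReal.ofReal ‖U y‖ ≤ ENNReal.ofReal C *
      (ENNReal.ofReal (1 + ‖y‖) * (∫⁻ z, ENNReal.ofReal (‖U z‖ * ker (z - y))) +
        ∫⁻ z, ENNReal.ofReal (‖U z‖ ^ 2 * ker (z - y))) := by
  obtain ⟨C₀, hC₀, hB⟩ := test_field_bounds_ker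
  set M := ∫ u, Psi 1 u with hM
  have hMpos : 0 < M := integral_Psi_one_pos
  set K : ℝ := ν * (3 * C₀) + ν * (3 * C₀) + a * (3 * C₀) + a * (18 * C₀) + 9 * C₀ with hK
  have hKpos : 0 < K := by positivity
  refine ⟨3 * K / (ν * M), by positivity, fun y => ?_⟩
  have hUcont : Continuous U := h.contDiff_velocity.continuous
  have hU1 := fun l => h.contDiff_one_comp l
  have hUc : ∀ l, Continuous (fun w => U w l) := fun l => (hU1 l).continuous
  set I₁ := ∫⁻ z, ENNReal.ofReal (‖U z‖ * ker (z - y)) with hI₁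
  set I₂ := ∫⁻ z, ENNReal.ofReal (‖U z‖ ^ 2 * ker (z - y)) with hI₂
  set S := ENNReal.ofReal (1 + ‖y‖) * I₁ + I₂ with hS
  have hI₁S : I₁ ≤ S := by
    calc I₁ = 1 * I₁ := (one_mul _).symm
      _ ≤ ENNReal.ofReal (1 + ‖y‖) * I₁ := by
          gcongr
          rw [← ENNReal.ofReal_one]
          exact ENNReal.ofReal_le_ofReal (by linarith [norm_nonneg y])
      _ ≤ S := le_self_add
  have hI₁S' : ENNReal.ofReal (1 + ‖y‖) * I₁ ≤ S := le_self_add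
  have hI₂S : I₂ ≤ S := le_add_self
  -- the `ε`-independent bound
  set E := ENNReal.ofReal (ν * (3 * C₀)) * I₁ + ENNReal.ofReal (ν * (3 * C₀)) * I₁ +
    ENNReal.ofReal (a * (3 * C₀)) * I₁ + ENNReal.ofReal (a * (18 * C₀)) * (ENNReal.ofReal (1 + ‖y‖) * I₁) +
    ENNReal.ofReal (9 * C₀) * I₂ with hE
  have hES : E ≤ ENNReal.ofReal K * S := by
    have e : ENNReal.ofReal K = ENNReal.ofReal (ν * (3 * C₀)) + ENNReal.ofReal (ν * (3 * C₀)) +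
        ENNReal.ofReal (a * (3 * C₀)) + ENNReal.ofReal (a * (18 * C₀)) + ENNReal.ofReal (9 * C₀) := by
      rw [hK, ENNReal.ofReal_add (by positivity) (by positivity), ENNReal.ofReal_add (by positivity) (by positivity),
        ENNReal.ofReal_add (by positivity) (by positivity), ENNReal.ofReal_add (by positivity) (by positivity)]
    rw [hE, e]
    simp only [add_mul]
    gcongr
  -- the claim for every `ε > 0` and every `j`
  have hclaim : ∀ ε : ℝ, 0 < ε → ∀ j : Fin 3,
      ENNReal.ofReal (ν * |∫ z, U z j * (cut (z - y) * Psi ε (z - y))|) ≤ E := by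
    intro ε hε j
    obtain ⟨hbV, hbdV, hbR, hbE⟩ := hB ε hε.ne' j
    have hid := integral_cut_Psi_eq (j := j) (y := y) h hε.ne'
    -- continuity / integrability of the five integrands
    have htr : ∀ {f : 𝔼 → ℝ}, ContDiff ℝ ∞ f → Continuous (fun z : 𝔼 => f (z - y)) := fun hf =>
      hf.continuous.comp (continuous_id.sub continuous_const)
    have iR : ∀ i, Integrable (fun z => U z i * R ε j i (z - y)) := fun i =>
      integrable_mul_of_hasCompactSupport_right (hUc i) (htr (contDiff_R hε.ne' i))
        (hasCompactSupport_comp_sub_right (fun x hx => R_eq_zero_of_mem i (mem_flatSet_of_gt hx)) y)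
    have iE : Integrable (fun z => (∑ i, U z i * dcut i (z - y)) * E1 ε j (z - y)) := by
      refine integrable_mul_of_hasCompactSupport_left (continuous_finsetSum _ fun i _ =>
        (hUc i).mul (htr (contDiff_dcut i))) ?_ (htr (contDiff_E1 hε.ne' j))
      exact HasCompactSupport.intro (isCompact_closedBall y 1) fun z hz => by
        rw [mem_closedBall, dist_eq_norm, not_le] at hz
        simp [dcut_eq_zero _ (mem_flatSet_of_gt hz)]
    have hVcont : ∀ i, Continuous (Vt ε j y i) := fun i => (contDiff_Vt hε.ne' i (n := 1)).continuous
    have hVc := fun i => hasCompactSupport_Vt (ε := ε) (j := j) (y := y) i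
    have hdVcont : ∀ l i, Continuous (dVt ε j y l i) := fun l i => (contDiff_dVt hε.ne' l i (n := 1)).continuous
    have hdVc := fun l i => hasCompactSupport_dVt (ε := ε) (j := j) (y := y) l i
    have iV : ∀ i, Integrable (fun z => U z i * Vt ε j y i z) := fun i =>
      integrable_mul_of_hasCompactSupport_right (hUc i) (hVcont i) (hVc i)
    have iC : ∀ i, Integrable (fun z => U z i * (3 * Vt ε j y i z + ∑ l, z l * dVt ε j y l i z)) := by
      intro i
      refine integrable_mul_of_hasCompactSupport_right (hUc i) ?_ ?_
      · exact (continuous_const.mul (hVcont i)).add (continuous_finsetSum _ fun l _ =>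
          ((continuous_apply l).comp (PiLp.continuous_ofLp 2 _)).mul (hdVcont l i))
      · exact (hVc i).mul_left.add (HasCompactSupport.intro (isCompact_closedBall y 1) fun z hz => by
          rw [mem_closedBall, dist_eq_norm, not_le] at hz
          exact Finset.sum_eq_zero fun l _ => by simp [dVt, dV_eq_zero_of_one_lt _ _ hz])
    have iD : ∀ i, Integrable (fun z => U z i * ∑ l, U z l * dVt ε j y l i z) := by
      intro i
      refine integrable_mul_of_hasCompactSupport_right (hUc i)
        (continuous_finsetSum _ fun l _ => (hUc l).mul (hdVcont l i)) ?_
      exact HasCompactSupport.intro (isCompact_closedBall y 1) fun z hz => by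
        rw [mem_closedBall, dist_eq_norm, not_le] at hz
        exact Finset.sum_eq_zero fun l _ => by simp [dVt, dV_eq_zero_of_one_lt _ _ hz]
    -- the a.e. pointwise majorants
    have hae := ae_ne y
    have hUi : ∀ z i, |U z i| ≤ ‖U z‖ := fun z i => abs_apply_le_norm U z i
    have m1 : ∀ i, ∀ᵐ z ∂(volume : Measure 𝔼), |U z i * R ε j i (z - y)| ≤ C₀ * (‖U z‖ * ker (z - y)) := by
      intro i
      filter_upwards [hae] with z hz
      rw [abs_mul]
      calc |U z i| * |R ε j i (z - y)| ≤ ‖U z‖ * (C₀ * ker (z - y)) :=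
            mul_le_mul (hUi z i) (hbR i _ (sub_ne_zero.2 hz)) (abs_nonneg _) (norm_nonneg _)
        _ = C₀ * (‖U z‖ * ker (z - y)) := by ring
    have m2 : ∀ᵐ z ∂(volume : Measure 𝔼), |(∑ i, U z i * dcut i (z - y)) * E1 ε j (z - y)| ≤
        (3 * C₀) * (‖U z‖ * ker (z - y)) := by
      filter_upwards [hae] with z hz
      rw [Finset.sum_mul]
      refine (Finset.abs_sum_le_sum_abs _ _).trans ?_
      have : ∀ i ∈ Finset.univ, |U z i * dcut i (z - y) * E1 ε j (z - y)| ≤ ‖U z‖ * (C₀ * ker (z - y)) := by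
        intro i _
        rw [mul_assoc, abs_mul]
        exact mul_le_mul (hUi z i) (hbE i _ (sub_ne_zero.2 hz)) (abs_nonneg _) (norm_nonneg _)
      refine (Finset.sum_le_sum this).trans (le_of_eq ?_)
      simp only [Finset.sum_const, Finset.card_univ, Fintype.card_fin, nsmul_eq_mul, Nat.cast_ofNat]
      ring
    have m3 : ∀ i, ∀ᵐ z ∂(volume : Measure 𝔼), |U z i * Vt ε j y i z| ≤ C₀ * (‖U z‖ * ker (z - y)) := by
      intro i
      filter_upwards [hae] with z hz
      rw [abs_mul]
      calc |U z i| * |Vt ε j y i z| ≤ ‖U z‖ * (C₀ * ker (z - y)) :=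
            mul_le_mul (hUi z i) (hbV i _ (sub_ne_zero.2 hz)) (abs_nonneg _) (norm_nonneg _)
        _ = C₀ * (‖U z‖ * ker (z - y)) := by ring
    have m4 : ∀ i, ∀ᵐ z ∂(volume : Measure 𝔼), |U z i * (3 * Vt ε j y i z + ∑ l, z l * dVt ε j y l i z)| ≤
        (6 * C₀ * (1 + ‖y‖)) * (‖U z‖ * ker (z - y)) := by
      intro i
      filter_upwards [hae] with z hz
      have hx : z - y ≠ 0 := sub_ne_zero.2 hz
      by_cases hx1 : ‖z - y‖ ≤ 1
      · have hz1 : ‖z‖ ≤ 1 + ‖y‖ := by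
          calc ‖z‖ = ‖(z - y) + y‖ := by rw [sub_add_cancel]
            _ ≤ ‖z - y‖ + ‖y‖ := norm_add_le _ _
            _ ≤ 1 + ‖y‖ := by linarith
        have hk := ker_nonneg (z - y)
        have hin : |3 * Vt ε j y i z + ∑ l, z l * dVt ε j y l i z| ≤ (3 + 3 * (1 + ‖y‖)) * (C₀ * ker (z - y)) := by
          refine (abs_add_le _ _).trans ?_
          have h1 : |3 * Vt ε j y i z| ≤ 3 * (C₀ * ker (z - y)) := by
            rw [abs_mul, abs_of_pos (by norm_num : (0:ℝ) < 3)]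
            exact mul_le_mul_of_nonneg_left (hbV i _ hx) (by norm_num)
          have h2 : |∑ l, z l * dVt ε j y l i z| ≤ 3 * ((1 + ‖y‖) * (C₀ * ker (z - y))) := by
            refine (Finset.abs_sum_le_sum_abs _ _).trans ?_
            have : ∀ l ∈ Finset.univ, |z l * dVt ε j y l i z| ≤ (1 + ‖y‖) * (C₀ * ker (z - y)) := by
              intro l _
              rw [abs_mul]
              exact mul_le_mul ((abs_coord_le_norm z l).trans hz1) (hbdV l i _ hx) (abs_nonneg _)
                (by positivity)
            exact (Finset.sum_le_sum this).trans (le_of_eq (by simp))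
          linarith
        rw [abs_mul]
        calc |U z i| * |3 * Vt ε j y i z + ∑ l, z l * dVt ε j y l i z|
            ≤ ‖U z‖ * ((3 + 3 * (1 + ‖y‖)) * (C₀ * ker (z - y))) :=
              mul_le_mul (hUi z i) hin (abs_nonneg _) (norm_nonneg _)
          _ ≤ ‖U z‖ * ((6 * (1 + ‖y‖)) * (C₀ * ker (z - y))) := by
              gcongr
              linarith [norm_nonneg y]
          _ = 6 * C₀ * (1 + ‖y‖) * (‖U z‖ * ker (z - y)) := by ring
      · have hgt : 1 < ‖z - y‖ := not_le.1 hx1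
        have e0 : 3 * Vt ε j y i z + ∑ l, z l * dVt ε j y l i z = 0 := by
          simp [Vt, dVt, V_eq_zero_of_one_lt _ hgt, dV_eq_zero_of_one_lt _ _ hgt]
        rw [e0, mul_zero, abs_zero]
        exact mul_nonneg (by positivity) (mul_nonneg (norm_nonneg _) (ker_nonneg _))
    have m5 : ∀ i, ∀ᵐ z ∂(volume : Measure 𝔼), |U z i * ∑ l, U z l * dVt ε j y l i z| ≤
        (3 * C₀) * (‖U z‖ ^ 2 * ker (z - y)) := by
      intro i
      filter_upwards [hae] with z hz
      have hx : z - y ≠ 0 := sub_ne_zero.2 hz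
      rw [abs_mul]
      have hin : |∑ l, U z l * dVt ε j y l i z| ≤ 3 * (‖U z‖ * (C₀ * ker (z - y))) := by
        refine (Finset.abs_sum_le_sum_abs _ _).trans ?_
        have : ∀ l ∈ Finset.univ, |U z l * dVt ε j y l i z| ≤ ‖U z‖ * (C₀ * ker (z - y)) := by
          intro l _
          rw [abs_mul]
          exact mul_le_mul (hUi z l) (hbdV l i _ hx) (abs_nonneg _) (norm_nonneg _)
        exact (Finset.sum_le_sum this).trans (le_of_eq (by simp))
      calc |U z i| * |∑ l, U z l * dVt ε j y l i z| ≤ ‖U z‖ * (3 * (‖U z‖ * (C₀ * ker (z - y)))) :=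
            mul_le_mul (hUi z i) hin (abs_nonneg _) (norm_nonneg _)
        _ = 3 * C₀ * (‖U z‖ ^ 2 * ker (z - y)) := by ring
    -- the five `ℝ≥0∞` bounds
    have b1 : ∀ i, ENNReal.ofReal |∫ z, U z i * R ε j i (z - y)| ≤ ENNReal.ofReal C₀ * I₁ :=
      fun i => ofReal_abs_integral_le (iR i) hC₀.le (m1 i)
    have b2 : ENNReal.ofReal |∫ z, (∑ i, U z i * dcut i (z - y)) * E1 ε j (z - y)| ≤
        ENNReal.ofReal (3 * C₀) * I₁ := ofReal_abs_integral_le iE (by positivity) m2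
    have b3 : ∀ i, ENNReal.ofReal |∫ z, U z i * Vt ε j y i z| ≤ ENNReal.ofReal C₀ * I₁ :=
      fun i => ofReal_abs_integral_le (iV i) hC₀.le (m3 i)
    have b4 : ∀ i, ENNReal.ofReal |∫ z, U z i * (3 * Vt ε j y i z + ∑ l, z l * dVt ε j y l i z)| ≤
        ENNReal.ofReal (6 * C₀ * (1 + ‖y‖)) * I₁ :=
      fun i => ofReal_abs_integral_le (iC i) (by positivity) (m4 i)
    have b5 : ∀ i, ENNReal.ofReal |∫ z, U z i * ∑ l, U z l * dVt ε j y l i z| ≤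
        ENNReal.ofReal (3 * C₀) * I₂ := fun i => ofReal_abs_integral_le (iD i) (by positivity) (m5 i)
    -- sums over `i`
    have hsum3 : ∀ {T : Fin 3 → ℝ} {B : ℝ≥0∞}, (∀ i, ENNReal.ofReal |T i| ≤ B) →
        ENNReal.ofReal |∑ i, T i| ≤ 3 * B := by
      intro T B hT
      calc ENNReal.ofReal |∑ i, T i| ≤ ENNReal.ofReal (∑ i, |T i|) :=
            ENNReal.ofReal_le_ofReal (Finset.abs_sum_le_sum_abs _ _)
        _ = ∑ i, ENNReal.ofReal |T i| := ENNReal.ofReal_sum_of_nonneg fun i _ => abs_nonneg _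
        _ ≤ ∑ i : Fin 3, B := Finset.sum_le_sum fun i _ => hT i
        _ = 3 * B := by simp
    -- assemble
    rw [show ν * |∫ z, U z j * (cut (z - y) * Psi ε (z - y))| =
      |ν * ∫ z, U z j * (cut (z - y) * Psi ε (z - y))| by rw [abs_mul, abs_of_pos hν], hid]
    have eabs : ∀ (r s : ℝ), 0 ≤ r → ENNReal.ofReal |r * s| = ENNReal.ofReal r * ENNReal.ofReal |s| := by
      intro r s hr; rw [abs_mul, abs_of_nonneg hr, ENNReal.ofReal_mul hr]
    calc _ ≤ ENNReal.ofReal (|ν * ∑ i, ∫ z, U z i * R ε j i (z - y)| +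
          |ν * ∫ z, (∑ i, U z i * dcut i (z - y)) * E1 ε j (z - y)| +
          |a * ∑ i, ∫ z, U z i * Vt ε j y i z| +
          |a * ∑ i, ∫ z, U z i * (3 * Vt ε j y i z + ∑ l, z l * dVt ε j y l i z)| +
          |∑ i, ∫ z, U z i * ∑ l, U z l * dVt ε j y l i z|) := by
          refine ENNReal.ofReal_le_ofReal ?_
          refine (abs_add_le _ _).trans (add_le_add ((abs_add_le _ _).trans (add_le_add ((abs_sub _ _).trans
            (add_le_add (abs_sub _ _) le_rfl)) le_rfl)) le_rfl)
      _ ≤ ENNReal.ofReal |ν * ∑ i, ∫ z, U z i * R ε j i (z - y)| +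
          ENNReal.ofReal |ν * ∫ z, (∑ i, U z i * dcut i (z - y)) * E1 ε j (z - y)| +
          ENNReal.ofReal |a * ∑ i, ∫ z, U z i * Vt ε j y i z| +
          ENNReal.ofReal |a * ∑ i, ∫ z, U z i * (3 * Vt ε j y i z + ∑ l, z l * dVt ε j y l i z)| +
          ENNReal.ofReal |∑ i, ∫ z, U z i * ∑ l, U z l * dVt ε j y l i z| := by
          refine (ENNReal.ofReal_add_le).trans (add_le_add ((ENNReal.ofReal_add_le).trans (add_le_add
            ((ENNReal.ofReal_add_le).trans (add_le_add (ENNReal.ofReal_add_le) le_rfl)) le_rfl)) le_rfl)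
      _ ≤ ENNReal.ofReal ν * (3 * (ENNReal.ofReal C₀ * I₁)) + ENNReal.ofReal ν * (ENNReal.ofReal (3 * C₀) * I₁) +
          ENNReal.ofReal a * (3 * (ENNReal.ofReal C₀ * I₁)) +
          ENNReal.ofReal a * (3 * (ENNReal.ofReal (6 * C₀ * (1 + ‖y‖)) * I₁)) +
          3 * (ENNReal.ofReal (3 * C₀) * I₂) := by
          rw [eabs _ _ hν.le, eabs _ _ hν.le, eabs _ _ ha, eabs _ _ ha]
          gcongr
          · exact hsum3 b1
          · exact hsum3 b3
          · exact hsum3 b4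
          · exact hsum3 b5
      _ = E := by
          rw [hE]
          have e1 : ENNReal.ofReal (6 * C₀ * (1 + ‖y‖)) = 6 * ENNReal.ofReal C₀ * ENNReal.ofReal (1 + ‖y‖) := by
            rw [ENNReal.ofReal_mul (by positivity), ENNReal.ofReal_mul (by norm_num), ENNReal.ofReal_ofNat]
          have e3 : ENNReal.ofReal (3 * C₀) = 3 * ENNReal.ofReal C₀ := by
            rw [ENNReal.ofReal_mul (by norm_num), ENNReal.ofReal_ofNat]
          have e9 : ENNReal.ofReal (9 * C₀) = 9 * ENNReal.ofReal C₀ := by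
            rw [ENNReal.ofReal_mul (by norm_num), ENNReal.ofReal_ofNat]
          have eν : ENNReal.ofReal (ν * (3 * C₀)) = ENNReal.ofReal ν * (3 * ENNReal.ofReal C₀) := by
            rw [ENNReal.ofReal_mul hν.le, e3]
          have ea3 : ENNReal.ofReal (a * (3 * C₀)) = ENNReal.ofReal a * (3 * ENNReal.ofReal C₀) := by
            rw [ENNReal.ofReal_mul ha, e3]
          have ea18 : ENNReal.ofReal (a * (18 * C₀)) = ENNReal.ofReal a * (18 * ENNReal.ofReal C₀) := by
            rw [ENNReal.ofReal_mul ha, ENNReal.ofReal_mul (by norm_num), ENNReal.ofReal_ofNat]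
          rw [e1, e3, e9, eν, ea3, ea18]
          ring
  -- conclusion
  by_cases hStop : S = ⊤
  · rw [hStop, ENNReal.mul_top (by simp [(show 0 < 3 * K / (ν * M) by positivity)])]
    exact le_top
  · have hSfin : S < ⊤ := lt_top_iff_ne_top.2 hStop
    have hEfin : E < ⊤ := lt_of_le_of_lt hES (ENNReal.mul_lt_top ENNReal.ofReal_lt_top hSfin)
    have hj : ∀ j, |U y j| * (ν * M) ≤ E.toReal := by
      intro j
      have hb : ∀ c : ℝ, 0 < c → ν * |∫ z, U z j * (cut (z - y) * Psi c⁻¹ (z - y))| ≤ E.toReal := by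
        intro c hc
        have h1 := hclaim c⁻¹ (inv_pos.2 hc) j
        exact (ENNReal.ofReal_le_iff_le_toReal hEfin.ne).1 h1
      have ht := ((tendsto_integral_cut_Psi hUcont j y).const_mul ν).abs
      have hle : |ν * (M * U y j)| ≤ E.toReal := by
        refine le_of_tendsto ht ?_
        filter_upwards [eventually_gt_atTop (0 : ℝ)] with c hc
        rw [abs_mul, abs_of_pos hν]
        exact hb c hc
      rw [abs_mul, abs_of_pos hν, abs_mul, abs_of_pos hMpos] at hle
      linarith
    have hnorm : ‖U y‖ * (ν * M) ≤ 3 * E.toReal := by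
      calc ‖U y‖ * (ν * M) ≤ (∑ j, |U y j|) * (ν * M) := by gcongr; exact norm_le_sum_abs (U y)
        _ = ∑ j, |U y j| * (ν * M) := Finset.sum_mul _ _ _
        _ ≤ ∑ j : Fin 3, E.toReal := Finset.sum_le_sum fun j _ => hj j
        _ = 3 * E.toReal := by simp
    have hνM : 0 < ν * M := by positivity
    calc ENNReal.ofReal ‖U y‖ ≤ ENNReal.ofReal (3 / (ν * M) * E.toReal) := by
          refine ENNReal.ofReal_le_ofReal ?_
          rw [div_mul_eq_mul_div, le_div_iff₀ hνM]
          linarith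
      _ = ENNReal.ofReal (3 / (ν * M)) * E := by
          rw [ENNReal.ofReal_mul (by positivity), ENNReal.ofReal_toReal hEfin.ne]
      _ ≤ ENNReal.ofReal (3 / (ν * M)) * (ENNReal.ofReal K * S) := by gcongr
      _ = ENNReal.ofReal (3 * K / (ν * M)) * S := by
          rw [← mul_assoc, ← ENNReal.ofReal_mul (by positivity)]
          congr 2
          ring

end Representation











end Stokeslet

end Literature.Analysis.FluidPDE
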